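import Literature.Geometry.Riemannian.LinearHeatCauchyNoncompact
import Literature.Geometry.Riemannian.WeightedHeatFlowFromLinearHeat
import HarnessLib

/-!
# The weighted heat flow on a complete (non-compact) weighted manifold: existence and a-priori estimates

Topic `Geometry/Riemannian`. Setting: `(M, g)` Riemannian, modelled on `ℝⁿ` (Hausdorff, second countable,
`T₃` — NOT compact), `V` smooth, `L = Δ_g − g⁻¹(dV, d·)`, the weighted measure `e^{-V} dV_g`; cut-offs
`IsLaplacianCutoff` / `IsWeightedCutoff` and classical solutions `IsWeightedHeatSolOn`
(`WeightedHeatCutoffCalculus.lean`). Proved here (the non-compact counterparts of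
`WeightedHeatFlowAPriori.lean` / `WeightedHeatFlowFromLinearHeat.lean`, closed manifolds):

* `exists_isWeightedHeatSolOn` — **existence** of the flow `∂ₛρ = Lρ` from a compactly perturbed constant
  `c₀ + ψ₀`, `ψ₀ ∈ C_c^∞`, on `[0, T]`, smooth on `M × O` (`O ⊇ [0, T]` open), with
  `(ρ − c₀)² e^{-V} ∈ L¹(M × (0, T))`, under `¼|∇V|² − ½ΔV + λ ≥ 1` and Laplacian cut-offs (the linear
  Cauchy problem `exists_linearHeat_cauchy_noncompact` for the potential `Q = ¼|∇V|² − ½ΔV + λ`,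
  exponential shift, conjugation by `e^{V/2}`: `heatDrift_of_potential`);
* `exists_convexTest`, `weightedMaxPrinciple` — the **weak maximum principle** for subsolutions
  `∂ₛz ≤ Lz` in the class `z₊ e^{-V} ∈ L¹(M × (0,T))` (energy method with weighted cut-offs);
* `IsWeightedHeatSolOn.twoSidedBound` — `c₁ ≤ ρ(0) ≤ C₁ ⇒ c₁ ≤ ρ ≤ C₁` for solutions with
  `(ρ − c₀)² e^{-V} ∈ L¹` of the strip (`e^{-V} ∈ L¹`);
* `abs_integral_cutoff_sub_le`, `IsWeightedHeatSolOn.integral_mul_exp_neg_eq` — **mass conservation**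
  `∫ ρ(s) e^{-V} = ∫ ρ(0) e^{-V}` for bounded solutions;
* `two_mul_integral_gradSq_cutoff_eq`, `IsWeightedHeatSolOn.integrable_gradSq_strip` — the **energy
  estimate** `∫∫_{M×(0,T)} |∇ρ|² e^{-V} ≤ ½ ∫ (ρ(0) − c₀)² e^{-V}`;
* `deriv_gradSq_of_heatFlow_isOpen`, `IsWeightedHeatSolOn.gradSq_le_exp` — **Bakry–Émery gradient decay**
  `|∇ρ(s)|² ≤ e^{-2Ks} sup|∇ρ₀|²` under `Ric + Hess V ≥ K g`.

This is the Literature home of the Summits-side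
`EntropyRungNoncompactShrinkerGapHeat{FlowExistence,MaxPrinciple,TwoSidedBound,MassConservation,EnergyEstimate,GradientDecay}`
(route SmoothPoincare4/EntropyRung; not importable from Literature, CONVENTIONS §2). Everything is proved;
no definitions, no named facts.

## References

* A. Grigor'yan, *Heat kernel and analysis on manifolds*, AMS/IP 2009, §8, §11.4, §12.1 (Cauchy problem,
  uniqueness class and integrated maximum principle on complete weighted manifolds). [Grigoryan2009]
* F. Trèves, *Basic Linear Partial Differential Equations* (1975), §41, Thm. 40.1, (41.9). [Treves1975]
* D. Bakry, I. Gentil, M. Ledoux, *Analysis and Geometry of Markov Diffusion Operators* (2014), §1.15.7,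
  §3.2, Thm. 3.2.4. [BakryGentilLedoux2014]
* J. A. Carrillo, L. Ni, Comm. Anal. Geom. 17 (2009), §3 (3.1)–(3.2) and the `C(K, ∞)` computation, §4.
  [CarrilloNi2009]
-/

noncomputable section

open scoped Manifold ContDiff ENNReal NNReal Topology
open MeasureTheory Set Filter

namespace Literature.Geometry.Riemannian

open Lorentzian Lorentzian.PseudoRiemannianMetric

/-! ### Existence of the weighted heat flow from a compactly perturbed constant -/

section Existence

variable {n : ℕ} {M : Type*} [TopologicalSpace M] [T2Space M] [SecondCountableTopology M]
  [ChartedSpace (EuclideanSpace ℝ (Fin n)) M] [IsManifold (𝓡 n) ∞ M] [T3Space M]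
  [MeasurableSpace M] [BorelSpace M]
  {g : PseudoRiemannianMetric (𝓡 n) ∞ (EuclideanSpace ℝ (Fin n)) (TangentSpace (𝓡 n) : M → Type _)}
  [g.HasLeviCivita]

/-- **The weighted heat flow from a compactly perturbed constant on a complete weighted manifold with
Laplacian cut-offs.** Setting: `(M, g)` Riemannian, modelled on `ℝⁿ` (Hausdorff, second countable, `T₃` —
NOT compact), `V` smooth with `¼|∇V|² − ½ΔV + λ ≥ 1`, Laplacian cut-offs (`IsLaplacianCutoff g η C`). For
`c₀ ∈ ℝ`, `ψ₀ ∈ C_c^∞(M)` and `T > 0` there is a classical solution `ρ` of `∂ₛρ = Δρ − g⁻¹(dV, dρ)` on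
`[0, T]`, smooth on `M × O` (`O ⊇ [0, T]` open) — `IsWeightedHeatSolOn g V ρ O T` — with `ρ(0) = c₀ + ψ₀`
and `(ρ − c₀)² e^{-V} ∈ L¹(M × (0, T))`. Proof: with the potential `Q = ¼|∇V|² − ½ΔV + λ ≥ 1` and the
datum `w₀ = e^{-V/2} ψ₀ ∈ C_c^∞`, the linear Cauchy problem (`exists_linearHeat_cauchy_noncompact`) gives
`w` smooth on `M × O` with `∂ₛw = Δw − Qw`, `w(0) = w₀`, `w ∈ L²` of the strip; then
`ρ = c₀ + e^{V/2} e^{λs} w`: the time shift removes `λ` and the conjugation by `e^{V/2}` turns the potential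
`¼|∇V|² − ½ΔV` into the drift (`heatDrift_of_potential`); finally `(ρ − c₀)² e^{-V} = e^{2λs} w² ≤ e^{2|λ|T} w²`.
[cite: Treves1975, §41, Thm. 40.1 and (41.9); BakryGentilLedoux2014, §1.15.7 (the `h`-transform)] -/
theorem exists_isWeightedHeatSolOn (hg : g.IsRiemannian) {V : M → ℝ} (hV : ContMDiff (𝓡 n) 𝓘(ℝ, ℝ) ∞ V)
    {lam : ℝ} (hlam : ∀ x, 1 ≤ g.gradSq V x / 4 - g.dalembertian V x / 2 + lam)
    {η : ℕ → M → ℝ} {C : ℝ} (hη : IsLaplacianCutoff g η C) (c₀ : ℝ) {ψ₀ : M → ℝ}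
    (hψ : ContMDiff (𝓡 n) 𝓘(ℝ, ℝ) ∞ ψ₀) (hψc : HasCompactSupport ψ₀) {T : ℝ} (hT : 0 < T) :
    ∃ (O : Set ℝ) (ρ : ℝ → M → ℝ), IsWeightedHeatSolOn g V ρ O T ∧ (∀ x, ρ 0 x = c₀ + ψ₀ x) ∧
      Integrable (fun p : M × ℝ ↦ (ρ p.2 p.1 - c₀) ^ 2 * Real.exp (-V p.1))
        ((g.riemVolume.prod (volume : Measure ℝ)).restrict (univ ×ˢ Ioo 0 T)) := by
  classical
  -- the potential `Q = ¼|∇V|² − ½ΔV + λ ≥ 1` (time independent)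
  set Q : ℝ → M → ℝ := fun _ x ↦ g.gradSq V x / 4 - g.dalembertian V x / 2 + lam with hQdef
  have hQs : ContMDiff ((𝓡 n).prod 𝓘(ℝ, ℝ)) 𝓘(ℝ, ℝ) ∞ (fun p : M × ℝ ↦ Q p.2 p.1) := by
    have h1 : ContMDiff (𝓡 n) 𝓘(ℝ, ℝ) ∞ (fun x ↦ g.gradSq V x / 4 - g.dalembertian V x / 2 + lam) :=
      (((contMDiff_gradSq g hV).div_const 4).sub ((contMDiff_dalembertian g hV).div_const 2)).add
        contMDiff_const
    exact h1.comp contMDiff_fst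
  have hQ1 : ∀ s x, 1 ≤ Q s x := fun s x ↦ hlam x
  -- the datum `w₀ = e^{-V/2} ψ₀`
  set w₀ : M → ℝ := fun x ↦ Real.exp (-(V x / 2)) * ψ₀ x with hw₀def
  have hw₀ : ContMDiff (𝓡 n) 𝓘(ℝ, ℝ) ∞ w₀ :=
    ((contMDiff_iff_contDiff.2 Real.contDiff_exp).comp (hV.div_const 2).neg).mul hψ
  have hw₀c : HasCompactSupport w₀ := hψc.mul_left
  -- the linear Cauchy problem
  obtain ⟨O, w, hO, hTO, hws, hw0, hweq, hwL2⟩ :=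
    exists_linearHeat_cauchy_noncompact hg hη hQs hQ1 hw₀ hw₀c hT
  -- the candidate `ρ = c₀ + e^{V/2} e^{λ s} w`
  set u : ℝ → M → ℝ := fun s x ↦ Real.exp (V x / 2) * (Real.exp (lam * s) * w s x) with hudef
  set ρ : ℝ → M → ℝ := fun s x ↦ 1 * u s x + c₀ with hρdef
  have hus : ContMDiffOn ((𝓡 n).prod 𝓘(ℝ, ℝ)) 𝓘(ℝ, ℝ) ∞ (fun p : M × ℝ ↦ u p.2 p.1) (univ ×ˢ O) := by
    have hE : ContMDiff ((𝓡 n).prod 𝓘(ℝ, ℝ)) 𝓘(ℝ, ℝ) ∞ (fun p : M × ℝ ↦ Real.exp (V p.1 / 2)) :=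
      ((contMDiff_iff_contDiff.2 Real.contDiff_exp).comp ((hV.comp contMDiff_fst).div_const 2))
    have hL : ContMDiff ((𝓡 n).prod 𝓘(ℝ, ℝ)) 𝓘(ℝ, ℝ) ∞ (fun p : M × ℝ ↦ Real.exp (lam * p.2)) :=
      (contMDiff_iff_contDiff.2 Real.contDiff_exp).comp (contMDiff_const.mul contMDiff_snd)
    exact hE.contMDiffOn.mul (hL.contMDiffOn.mul hws)
  have hρs : ContMDiffOn ((𝓡 n).prod 𝓘(ℝ, ℝ)) 𝓘(ℝ, ℝ) ∞ (fun p : M × ℝ ↦ ρ p.2 p.1) (univ ×ˢ O) :=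
    (contMDiffOn_const.mul hus).add contMDiffOn_const
  refine ⟨O, ρ, ⟨hO, hTO, hρs, fun s hs x ↦ ?_⟩, fun x ↦ ?_, ?_⟩
  · -- the equation: exponential shift, then conjugation by `e^{V/2}`
    have hsO : s ∈ O := hTO hs
    have h2 : (2 : ℕ∞ω) ≤ (∞ : ℕ∞ω) := by norm_cast
    have hslice : ContMDiff (𝓡 n) 𝓘(ℝ, ℝ) ∞ (w s) :=
      hws.comp_contMDiff (contMDiff_id.prodMk contMDiff_const) fun y ↦ ⟨mem_univ _, hsO⟩
    have hws2 : ContMDiffAt (𝓡 n) 𝓘(ℝ, ℝ) 2 (w s) x := (hslice.of_le h2).contMDiffAt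
    -- the shifted function `w̃ = e^{λ s} w`
    set wt : ℝ → M → ℝ := fun r y ↦ Real.exp (lam * r) * w r y with hwtdef
    have hwt2 : ContMDiffAt (𝓡 n) 𝓘(ℝ, ℝ) 2 (wt s) x := (contMDiffAt_const.mul hws2 :)
    have hdw : HasDerivAt (fun r ↦ w r x) (g.dalembertian (w s) x - Q s x * w s x) s := by
      rw [← hweq s hs x]
      exact hasDerivAt_time_of_contMDiffOn hO hws x hsO
    have hdE : HasDerivAt (fun r : ℝ ↦ Real.exp (lam * r)) (lam * Real.exp (lam * s)) s := by
      have := ((hasDerivAt_id s).const_mul lam).exp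
      simpa [mul_comm] using this
    have hdwt : HasDerivAt (fun r ↦ wt r x)
        (g.dalembertian (wt s) x - (g.gradSq V x / 4 - g.dalembertian V x / 2) * wt s x) s := by
      have h := hdE.mul hdw
      have hΔ : g.dalembertian (wt s) x = Real.exp (lam * s) * g.dalembertian (w s) x := by
        show g.dalembertian (fun y ↦ Real.exp (lam * s) * w s y) x = _
        exact g.dalembertian_const_mul_of_contMDiffAt hws2 _
      rw [hΔ]
      refine h.congr_deriv ?_
      simp only [hwtdef, hQdef]
      ring
    have hconj := heatDrift_of_potential g hV (S := univ) hwt2 hdwt.hasDerivWithinAt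
    have hdu : HasDerivAt (fun r ↦ u r x)
        (g.dalembertian (u s) x - g.innerDual x (mvfderiv (𝓡 n) V x).toLinearMap
          (mvfderiv (𝓡 n) (u s) x).toLinearMap) s := by
      have h := hconj.hasDerivAt (Filter.univ_mem)
      simpa [hudef, hwtdef] using h
    have hdρ : HasDerivAt (fun r ↦ ρ r x)
        (1 * (g.dalembertian (u s) x - g.innerDual x (mvfderiv (𝓡 n) V x).toLinearMap
          (mvfderiv (𝓡 n) (u s) x).toLinearMap)) s := by
      have := (hdu.const_mul 1).add_const c₀
      simpa [hρdef] using this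
    rw [hdρ.deriv]
    have hu2 : ContMDiffAt (𝓡 n) 𝓘(ℝ, ℝ) 2 (u s) x := by
      have hA : ContMDiffAt (𝓡 n) 𝓘(ℝ, ℝ) 2 (fun y ↦ Real.exp (V y / 2)) x :=
        (((contMDiff_iff_contDiff.2 Real.contDiff_exp).comp (hV.div_const 2)).of_le h2).contMDiffAt
      exact hA.mul hwt2
    have haff := weightedLaplacian_affine (g := g) (V := V) hu2 1 c₀
    rw [show ρ s = fun y ↦ 1 * u s y + c₀ from rfl, haff]
  · -- `ρ(0) = c₀ + ψ₀`
    have h1 : Real.exp (V x / 2) * Real.exp (-(V x / 2)) = 1 := by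
      rw [← Real.exp_add]; simp
    simp only [hρdef, hudef, hw0, hw₀def, mul_zero, Real.exp_zero, one_mul]
    calc Real.exp (V x / 2) * (Real.exp (-(V x / 2)) * ψ₀ x) + c₀
        = (Real.exp (V x / 2) * Real.exp (-(V x / 2))) * ψ₀ x + c₀ := by ring
      _ = c₀ + ψ₀ x := by rw [h1]; ring
  · -- `(ρ − c₀)² e^{-V} = e^{2λs} w² ≤ e^{2|λ|T} w²` on the strip
    have hmeasS : MeasurableSet ((univ : Set M) ×ˢ Ioo (0 : ℝ) T) := MeasurableSet.univ.prod measurableSet_Ioo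
    refine (hwL2.const_mul (Real.exp (2 * |lam| * T))).mono' ?_ ?_
    · have hsub : (univ : Set M) ×ˢ Ioo (0 : ℝ) T ⊆ univ ×ˢ O :=
        Set.prod_mono le_rfl fun s hs ↦ hTO (Ioo_subset_Icc_self hs)
      have hρc : ContinuousOn (fun p : M × ℝ ↦ ρ p.2 p.1) ((univ : Set M) ×ˢ Ioo (0 : ℝ) T) :=
        hρs.continuousOn.mono hsub
      have hc : ContinuousOn (fun p : M × ℝ ↦ (ρ p.2 p.1 - c₀) ^ 2 * Real.exp (-V p.1))
          ((univ : Set M) ×ˢ Ioo (0 : ℝ) T) :=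
        ((hρc.sub continuousOn_const).pow 2).mul
          (Real.continuous_exp.comp (hV.continuous.comp continuous_fst).neg).continuousOn
      exact hc.aestronglyMeasurable hmeasS
    · rw [ae_restrict_iff' hmeasS]
      refine Eventually.of_forall fun p hp ↦ ?_
      obtain ⟨-, hs⟩ := hp
      have h1 : (ρ p.2 p.1 - c₀) ^ 2 * Real.exp (-V p.1) = Real.exp (2 * (lam * p.2)) * w p.2 p.1 ^ 2 := by
        simp only [hρdef, hudef]
        have hE : Real.exp (V p.1 / 2) ^ 2 * Real.exp (-V p.1) = 1 := by
          rw [sq, ← Real.exp_add, ← Real.exp_add]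
          convert Real.exp_zero using 2
          ring
        have hL : Real.exp (lam * p.2) ^ 2 = Real.exp (2 * (lam * p.2)) := by
          rw [sq, ← Real.exp_add]
          congr 1
          ring
        calc (1 * (Real.exp (V p.1 / 2) * (Real.exp (lam * p.2) * w p.2 p.1)) + c₀ - c₀) ^ 2 * Real.exp (-V p.1)
            = (Real.exp (V p.1 / 2) ^ 2 * Real.exp (-V p.1)) * (Real.exp (lam * p.2) ^ 2 * w p.2 p.1 ^ 2) := by
              ring
          _ = Real.exp (2 * (lam * p.2)) * w p.2 p.1 ^ 2 := by rw [hE, hL, one_mul]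
      rw [Real.norm_eq_abs, h1, abs_of_nonneg (by positivity)]
      refine mul_le_mul_of_nonneg_right (Real.exp_le_exp.2 ?_) (sq_nonneg _)
      have h3 : lam * p.2 ≤ |lam| * T := by
        calc lam * p.2 ≤ |lam| * p.2 := mul_le_mul_of_nonneg_right (le_abs_self _) hs.1.le
          _ ≤ |lam| * T := mul_le_mul_of_nonneg_left hs.2.le (abs_nonneg _)
      linarith

end Existence

section MaxPrinciple

variable {n : ℕ} {M : Type*} [TopologicalSpace M] [T2Space M] [SecondCountableTopology M]
  [ChartedSpace (EuclideanSpace ℝ (Fin n)) M] [IsManifold (𝓡 n) ∞ M] [T3Space M]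
  [MeasurableSpace M] [BorelSpace M]
  {g : PseudoRiemannianMetric (𝓡 n) ∞ (EuclideanSpace ℝ (Fin n)) (TangentSpace (𝓡 n) : M → Type _)}
  [g.HasLeviCivita]

/-! ### A smooth convex nondecreasing test function vanishing on `(-∞, 0]` -/

/-- **A smooth convex test function for the energy method.** There is `Φ : ℝ → ℝ` of class
`C^∞`, vanishing on `(-∞, 0]`, with `0 ≤ Φ' ≤ 1`, `Φ'' ≥ 0`, `0 ≤ Φ(t) ≤ t₊` and `Φ(t) = 0` only
for `t ≤ 0`: the primitive `Φ(t) = ∫₀ᵗ ψ` of Mathlib's smooth transition `ψ = Real.smoothTransition`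
(`ψ = 0` on `(-∞, 0]`, `0 < ψ ≤ 1` on `(0, ∞)`, `ψ` monotone). [folklore] -/
theorem exists_convexTest : ∃ Φ : ℝ → ℝ, ContDiff ℝ ∞ Φ ∧ (∀ t ≤ 0, Φ t = 0) ∧
    (∀ t, 0 ≤ deriv Φ t ∧ deriv Φ t ≤ 1) ∧ (∀ t, 0 ≤ deriv (deriv Φ) t) ∧
    (∀ t, 0 ≤ Φ t ∧ Φ t ≤ max t 0) ∧ (∀ t, Φ t = 0 → t ≤ 0) := by
  set Φ : ℝ → ℝ := fun t ↦ ∫ x in (0 : ℝ)..t, Real.smoothTransition x with hΦ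
  have hc : Continuous Real.smoothTransition := Real.smoothTransition.continuous
  have hd : deriv Φ = Real.smoothTransition := by
    funext t
    exact hc.deriv_integral _ 0 t
  have hdiff : Differentiable ℝ Φ := fun t ↦
    (hc.integral_hasStrictDerivAt 0 t).hasDerivAt.differentiableAt
  have hsmooth : ContDiff ℝ ∞ Φ := by
    rw [contDiff_infty_iff_deriv, hd]
    exact ⟨hdiff, Real.smoothTransition.contDiff⟩
  have hneg : ∀ t ≤ 0, Φ t = 0 := by
    intro t ht
    show ∫ x in (0 : ℝ)..t, Real.smoothTransition x = 0
    rw [intervalIntegral.integral_congr (g := fun _ ↦ (0 : ℝ)) ?_, intervalIntegral.integral_zero]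
    intro x hx
    rw [uIcc_of_ge ht] at hx
    exact Real.smoothTransition.zero_of_nonpos hx.2
  refine ⟨Φ, hsmooth, hneg, ?_, ?_, ?_, ?_⟩
  · intro t
    rw [hd]
    exact ⟨Real.smoothTransition.nonneg t, Real.smoothTransition.le_one t⟩
  · intro t
    rw [hd]
    exact Real.smoothTransition.monotone.deriv_nonneg
  · intro t
    rcases le_or_gt t 0 with ht | ht
    · rw [hneg t ht]
      exact ⟨le_rfl, le_max_right _ _⟩
    · refine ⟨intervalIntegral.integral_nonneg ht.le fun x _ ↦ Real.smoothTransition.nonneg x, ?_⟩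
      calc Φ t ≤ ∫ _ in (0 : ℝ)..t, (1 : ℝ) :=
            intervalIntegral.integral_mono_on ht.le (hc.intervalIntegrable _ _)
              intervalIntegrable_const (fun x _ ↦ Real.smoothTransition.le_one x)
        _ = t := by simp
        _ ≤ max t 0 := le_max_left _ _
  · intro t h
    by_contra hlt
    have hlt' : 0 < t := lt_of_not_ge hlt
    have hpos : 0 < Φ t := intervalIntegral.intervalIntegral_pos_of_pos_on
      (hc.intervalIntegrable _ _) (fun x hx ↦ Real.smoothTransition.pos_of_pos hx.1) hlt'
    exact hpos.ne' h

/-! ### The weighted maximum principle -/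

/-- **Weak maximum principle for subsolutions of the weighted heat equation on a complete
weighted manifold with weighted cut-offs (`IsWeightedCutoff g V η C`), in the class
`z₊ e^{-V} ∈ L¹(M × (0,T))`.** Energy method with cut-offs: for the
convex test function `Φ` of `exists_convexTest` and `E_k(s) = ∫ Φ(z(s,·)) η_k e^{-V}`, the Leibniz
rule (compactly supported weight) and the dissipation inequality `integral_test_dissipation_le` give
`E_k' ≤ ∫ |Lη_k| Φ(z) e^{-V}` on `[0, T]`, whence `0 ≤ E_k(s) ≤ ∫∫_{M×(0,T)} |Lη_k| Φ(z) e^{-V} → 0`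
(`E_k(0) = 0`, `|Lη_k| ≤ C`, `Lη_k → 0` pointwise, `Φ(z) ≤ z₊`, dominated convergence); as `E_k` is
nondecreasing in `k`, every `E_k(s)` vanishes, so `Φ(z(s,·)) η_k = 0` and `z(s, x) ≤ 0` wherever
some `η_k(x) = 1`. [cite: Grigoryan2009, §11.4 and §12.1 (uniqueness class and integrated maximum
principle for the Cauchy problem on complete weighted manifolds, energy estimates with cut-offs)] -/
theorem weightedMaxPrinciple (hg : g.IsRiemannian) {V : M → ℝ} (hV : ContMDiff (𝓡 n) 𝓘(ℝ, ℝ) ∞ V)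
    {η : ℕ → M → ℝ} {C : ℝ} (hη : IsWeightedCutoff g V η C) {T : ℝ} {O : Set ℝ} {z : ℝ → M → ℝ}
    (hT : 0 < T) (hO : IsOpen O) (hTO : Icc 0 T ⊆ O)
    (hz : ContMDiffOn ((𝓡 n).prod 𝓘(ℝ, ℝ)) 𝓘(ℝ, ℝ) ∞ (fun p : M × ℝ ↦ z p.2 p.1) (univ ×ˢ O))
    (hsub : ∀ s ∈ Icc 0 T, ∀ x, deriv (fun r ↦ z r x) s ≤ g.dalembertian (z s) x
      - g.innerDual x (mvfderiv (𝓡 n) V x).toLinearMap (mvfderiv (𝓡 n) (z s) x).toLinearMap)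
    (hz0 : ∀ x, z 0 x ≤ 0)
    (hint : Integrable (fun p : M × ℝ ↦ max (z p.2 p.1) 0 * Real.exp (-V p.1))
      ((g.riemVolume.prod (volume : Measure ℝ)).restrict (univ ×ˢ Ioo 0 T)))
    {s₀ : ℝ} (hs₀ : s₀ ∈ Icc 0 T) (x₀ : M) : z s₀ x₀ ≤ 0 := by
  obtain ⟨⟨hηs, hηc, hη01, hηmono, hη1⟩, hLη⟩ := id hη
  -- topology and measure
  haveI : LocallyCompactSpace M := Manifold.locallyCompact_of_finiteDimensional (M := M) (𝓡 n)
  haveI : IsFiniteMeasureOnCompacts g.riemVolume :=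
    CarrilloNi2009_shrinkerLSI.isFiniteMeasureOnCompacts_riemVolume hg
  haveI : IsLocallyFiniteMeasure g.riemVolume := isLocallyFiniteMeasure_of_isFiniteMeasureOnCompacts
  haveI : g.riemVolume.IsOpenPosMeasure := by
    rw [PseudoRiemannianMetric.riemVolume_eq hg]; exact isOpenPosMeasure_riemannianMeasure _
  set μ : Measure M := g.riemVolume with hμ
  -- the test function
  obtain ⟨Φ, hΦs, hΦneg, hΦ', hΦ'', hΦbd, hΦzero⟩ := exists_convexTest
  have hΦd : ∀ t, HasDerivAt Φ (deriv Φ t) t := fun t ↦ (hΦs.differentiable (by simp) t).hasDerivAt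
  have hΦc : Continuous Φ := hΦs.continuous
  have hΦ'c : Continuous (deriv Φ) := hΦs.continuous_deriv (by simp)
  -- the weighted Laplacians `ℓ k = Lη_k` of the cut-offs
  set ℓ : ℕ → M → ℝ := fun k x ↦ g.dalembertian (η k) x -
    g.innerDual x (mvfderiv (𝓡 n) V x).toLinearMap (mvfderiv (𝓡 n) (η k) x).toLinearMap with hℓ
  have hℓc : ∀ k, Continuous (ℓ k) := fun k ↦
    (continuous_hasCompactSupport_weightedLaplacian (g := g) (hηs k) (hηc k) hV).1
  have hℓs : ∀ k, HasCompactSupport (ℓ k) := fun k ↦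
    (continuous_hasCompactSupport_weightedLaplacian (g := g) (hηs k) (hηc k) hV).2
  have hC0 : 0 ≤ C := (abs_nonneg _).trans (hLη 0 x₀)
  have hℓ0 : ∀ x, ∀ᶠ k in atTop, ℓ k x = 0 := fun x ↦ (hη1 x).mono fun k hk ↦
    weightedLaplacian_eq_zero_of_eventuallyEq_one (g := g) (V := V) (hηs k) hk
  -- regularity of `z`: slices, joint continuity, time derivative
  have hexpc : Continuous fun x ↦ Real.exp (-V x) := Real.continuous_exp.comp hV.continuous.neg
  have hzs : ∀ s ∈ O, ContMDiff (𝓡 n) 𝓘(ℝ, ℝ) ∞ (z s) := fun s hs ↦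
    contMDiff_slice_of_contMDiffOn hz hs
  have hswap : ∀ p ∈ O ×ˢ (univ : Set M), (Prod.swap p) ∈ (univ : Set M) ×ˢ O :=
    fun p hp ↦ ⟨mem_univ _, hp.1⟩
  have hzc : ContinuousOn (fun p : ℝ × M ↦ z p.1 p.2) (O ×ˢ univ) :=
    hz.continuousOn.comp continuous_swap.continuousOn hswap
  have hdz : ContMDiffOn ((𝓡 n).prod 𝓘(ℝ, ℝ)) 𝓘(ℝ, ℝ) ∞
      (fun p : M × ℝ ↦ deriv (fun r ↦ z r p.1) p.2) (univ ×ˢ O) := by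
    have h := contMDiffOn_derivWithin_time_of_uniqueDiffOn (I := 𝓡 n) (u := z) hO.uniqueDiffOn hz
    exact h.congr fun p hp ↦ (derivWithin_of_isOpen hO hp.2).symm
  have hzd : ∀ s ∈ O, ∀ x, HasDerivAt (fun r ↦ z r x) (deriv (fun r ↦ z r x) s) s := by
    intro s hs x
    have h := hasDerivWithinAt_time_of_contMDiffOn (I := 𝓡 n) (k := ∞) (by simp) hz x hs
    exact (h.hasDerivAt (hO.mem_nhds hs)).differentiableAt.hasDerivAt
  have hdzc : ContinuousOn (fun p : ℝ × M ↦ deriv (fun r ↦ z r p.2) p.1) (O ×ˢ univ) :=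
    hdz.continuousOn.comp continuous_swap.continuousOn hswap
  -- the integrands `F = Φ(z)`, `F' = Φ'(z) ∂ₛz`
  set F : ℝ → M → ℝ := fun s x ↦ Φ (z s x) with hF
  set F' : ℝ → M → ℝ := fun s x ↦ deriv Φ (z s x) * deriv (fun r ↦ z r x) s with hF'
  have hFc : ContinuousOn (Function.uncurry F) (O ×ˢ univ) := hΦc.comp_continuousOn hzc
  have hF'c : ContinuousOn (Function.uncurry F') (O ×ˢ univ) :=
    (hΦ'c.comp_continuousOn hzc).mul hdzc
  have hFd : ∀ s ∈ O, ∀ x, HasDerivAt (F · x) (F' s x) s := fun s hs x ↦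
    (hΦd (z s x)).comp s (hzd s hs x)
  have hFsc : ∀ s ∈ O, Continuous (F s) := fun s hs ↦ hΦc.comp (hzs s hs).continuous
  have hF'sc : ∀ s ∈ O, Continuous (F' s) := fun s hs ↦
    hF'c.comp_continuous (Continuous.prodMk_right s) fun x ↦ ⟨hs, mem_univ _⟩
  -- the weights `h k = η_k e^{-V}`, energies `E k`, derivatives `E' k`, dissipation bounds `a k`
  set h : ℕ → M → ℝ := fun k x ↦ η k x * Real.exp (-V x) with hh
  have hhc : ∀ k, Continuous (h k) := fun k ↦ (hηs k).continuous.mul hexpc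
  have hhs : ∀ k, HasCompactSupport (h k) := fun k ↦ (hηc k).mul_right
  have hh0 : ∀ k x, 0 ≤ h k x := fun k x ↦ mul_nonneg (hη01 k x).1 (Real.exp_pos _).le
  set E : ℕ → ℝ → ℝ := fun k s ↦ ∫ x, h k x • F s x ∂μ with hE
  set E' : ℕ → ℝ → ℝ := fun k s ↦ ∫ x, h k x • F' s x ∂μ with hE'
  set a : ℕ → ℝ → ℝ := fun k s ↦ ∫ x, (|ℓ k x| * Real.exp (-V x)) • F s x ∂μ with ha
  have hEd : ∀ k, ∀ s ∈ O, HasDerivAt (E k) (E' k s) s := fun k s hs ↦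
    Literature.Analysis.FluidPDE.hasDerivAt_integral_smul_of_continuousOn (hhc k) (hhs k) hO hFc
      hF'c hFd hs
  have hE'c : ∀ k, ContinuousOn (E' k) O := fun k ↦
    Literature.Analysis.FluidPDE.continuousOn_integral_smul_of_continuousOn (hhc k) (hhs k) hF'c
  have hℓec : ∀ k, Continuous fun x ↦ |ℓ k x| * Real.exp (-V x) := fun k ↦ (hℓc k).abs.mul hexpc
  have hℓes : ∀ k, HasCompactSupport fun x ↦ |ℓ k x| * Real.exp (-V x) := fun k ↦
    ((hℓs k).comp_left (g := fun t : ℝ ↦ |t|) abs_zero).mul_right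
  have hac : ∀ k, ContinuousOn (a k) O := fun k ↦
    Literature.Analysis.FluidPDE.continuousOn_integral_smul_of_continuousOn (hℓec k) (hℓes k) hFc
  have ha0 : ∀ k s, 0 ≤ a k s := fun k s ↦ integral_nonneg fun x ↦
    mul_nonneg (mul_nonneg (abs_nonneg _) (Real.exp_pos _).le) (hΦbd _).1
  -- the dissipation bound `E' ≤ a` on `[0, T]`
  have hE'le : ∀ k, ∀ s ∈ Icc 0 T, E' k s ≤ a k s := by
    intro k s hs
    have hsO := hTO hs
    have hws := hzs s hsO
    have hLc : Continuous fun x ↦ g.dalembertian (z s) x -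
        g.innerDual x (mvfderiv (𝓡 n) V x).toLinearMap (mvfderiv (𝓡 n) (z s) x).toLinearMap :=
      (continuous_dalembertian g (hws.of_le (WithTop.coe_le_coe.mpr le_top))).sub
        (continuous_innerDual_mvfderiv g (hV.of_le (by norm_num)) (hws.of_le (by norm_num)))
    have i1 : Integrable (fun x ↦ h k x • F' s x) μ :=
      ((hhc k).smul (hF'sc s hsO)).integrable_of_hasCompactSupport ((hhs k).smul_right)
    have i2 : Integrable (fun x ↦ h k x • (deriv Φ (z s x) * (g.dalembertian (z s) x -
        g.innerDual x (mvfderiv (𝓡 n) V x).toLinearMap (mvfderiv (𝓡 n) (z s) x).toLinearMap))) μ :=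
      ((hhc k).smul ((hΦ'c.comp hws.continuous).mul hLc)).integrable_of_hasCompactSupport
        ((hhs k).smul_right)
    have step1 : E' k s ≤ ∫ x, h k x • (deriv Φ (z s x) * (g.dalembertian (z s) x -
        g.innerDual x (mvfderiv (𝓡 n) V x).toLinearMap (mvfderiv (𝓡 n) (z s) x).toLinearMap))
        ∂μ := by
      refine integral_mono i1 i2 fun x ↦ ?_
      exact mul_le_mul_of_nonneg_left (mul_le_mul_of_nonneg_left (hsub s hs x) (hΦ' _).1) (hh0 k x)
    have step2 := integral_test_dissipation_le hg hws (hηs k) (hηc k) (fun x ↦ (hη01 k x).1) hV hΦs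
      (fun t ↦ (hΦbd t).1) hΦ''
    exact step1.trans step2
  -- integrating in time: `E k s₀ ≤ ∫₀ᵀ a k`
  have hEbound : ∀ k, E k s₀ ≤ ∫ s in (0 : ℝ)..T, a k s := by
    intro k
    have hIcc : Icc 0 s₀ ⊆ O := fun s hs ↦ hTO ⟨hs.1, hs.2.trans hs₀.2⟩
    have hderiv : ∀ s ∈ uIcc 0 s₀, HasDerivAt (E k) (E' k s) s := by
      intro s hs
      rw [uIcc_of_le hs₀.1] at hs
      exact hEd k s (hIcc hs)
    have hE'i : IntervalIntegrable (E' k) volume 0 s₀ :=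
      ((hE'c k).mono (by rw [uIcc_of_le hs₀.1]; exact hIcc)).intervalIntegrable
    have hai : IntervalIntegrable (a k) volume 0 T :=
      ((hac k).mono (by rw [uIcc_of_le hT.le]; exact hTO)).intervalIntegrable
    have hai' : IntervalIntegrable (a k) volume 0 s₀ :=
      ((hac k).mono (by rw [uIcc_of_le hs₀.1]; exact hIcc)).intervalIntegrable
    have hFTC := intervalIntegral.integral_eq_sub_of_hasDerivAt hderiv hE'i
    have hE0 : E k 0 = 0 := by
      refine integral_eq_zero_of_ae (ae_of_all _ fun x ↦ ?_)
      simp [hF, hΦneg _ (hz0 x)]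
    calc E k s₀ = ∫ s in (0 : ℝ)..s₀, E' k s := by rw [hFTC, hE0, sub_zero]
      _ ≤ ∫ s in (0 : ℝ)..s₀, a k s := intervalIntegral.integral_mono_on hs₀.1 hE'i hai'
          fun s hs ↦ hE'le k s ⟨hs.1, hs.2.trans hs₀.2⟩
      _ ≤ ∫ s in (0 : ℝ)..T, a k s := intervalIntegral.integral_mono_interval le_rfl hs₀.1 hs₀.2
          (ae_restrict_of_forall_mem measurableSet_Ioc fun s _ ↦ ha0 k s) hai
  -- the strip integrals and their limit
  set ν : Measure (M × ℝ) := (μ.prod (volume : Measure ℝ)).restrict (univ ×ˢ Ioo 0 T) with hν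
  set G : ℕ → M × ℝ → ℝ := fun k p ↦ (|ℓ k p.1| * Real.exp (-V p.1)) • F p.2 p.1 with hG
  have hνeq : ν = μ.prod ((volume : Measure ℝ).restrict (Ioo 0 T)) := by
    rw [hν, ← Measure.prod_restrict, Measure.restrict_univ]
  have hGm : ∀ k, AEStronglyMeasurable (G k) ν := by
    intro k
    have hcont : ContinuousOn (G k) (univ ×ˢ O) := by
      refine ((((hℓc k).abs.mul hexpc).comp continuous_fst).continuousOn).smul ?_
      exact hΦc.comp_continuousOn hz.continuousOn
    exact (hcont.mono (prod_mono le_rfl (Ioo_subset_Icc_self.trans hTO))).aestronglyMeasurable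
      (MeasurableSet.univ.prod measurableSet_Ioo)
  have hGbd : ∀ k p, ‖G k p‖ ≤ C * (max (z p.2 p.1) 0 * Real.exp (-V p.1)) := by
    intro k p
    have h1 := hLη k p.1
    have h2 := (hΦbd (z p.2 p.1)).2
    have h3 := (hΦbd (z p.2 p.1)).1
    have hex := Real.exp_pos (-V p.1)
    rw [Real.norm_eq_abs, hG]
    simp only [smul_eq_mul]
    rw [abs_of_nonneg (mul_nonneg (mul_nonneg (abs_nonneg _) hex.le) h3)]
    calc |ℓ k p.1| * Real.exp (-V p.1) * Φ (z p.2 p.1)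
        ≤ C * Real.exp (-V p.1) * max (z p.2 p.1) 0 := by gcongr
      _ = C * (max (z p.2 p.1) 0 * Real.exp (-V p.1)) := by ring
  have hGi : ∀ k, Integrable (G k) ν := fun k ↦
    (hint.const_mul C).mono' (hGm k) (ae_of_all _ (hGbd k))
  have hstrip : ∀ k, ∫ s in (0 : ℝ)..T, a k s = ∫ p, G k p ∂ν := by
    intro k
    rw [intervalIntegral.integral_of_le hT.le, integral_Ioc_eq_integral_Ioo, hνeq,
      integral_prod_symm (G k) (by rw [← hνeq]; exact hGi k)]
  have hlim : Tendsto (fun k ↦ ∫ p, G k p ∂ν) atTop (𝓝 0) := by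
    have h := tendsto_integral_of_dominated_convergence (F := G) (f := fun _ ↦ (0 : ℝ))
      (fun p ↦ C * (max (z p.2 p.1) 0 * Real.exp (-V p.1))) hGm (hint.const_mul C)
      (fun k ↦ ae_of_all _ (hGbd k)) (ae_of_all _ fun p ↦ ?_)
    · simpa using h
    · refine tendsto_const_nhds.congr' ?_
      filter_upwards [hℓ0 p.1] with k hk
      simp [hG, hk]
  -- every energy vanishes at `s₀`
  have hs₀O := hTO hs₀
  have hEi : ∀ k, Integrable (fun x ↦ h k x • F s₀ x) μ := fun k ↦
    ((hhc k).smul (hFsc s₀ hs₀O)).integrable_of_hasCompactSupport ((hhs k).smul_right)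
  have hEmono : ∀ k j, k ≤ j → E k s₀ ≤ E j s₀ := by
    intro k j hkj
    refine integral_mono (hEi k) (hEi j) fun x ↦ ?_
    have hηle : η k x ≤ η j x := (monotone_nat_of_le_succ fun m ↦ hηmono m x) hkj
    exact mul_le_mul_of_nonneg_right (mul_le_mul_of_nonneg_right hηle (Real.exp_pos _).le)
      (hΦbd _).1
  have hEzero : ∀ k, E k s₀ = 0 := by
    intro k
    refine le_antisymm ?_ (integral_nonneg fun x ↦ mul_nonneg (hh0 k x) (hΦbd _).1)
    have hb : Tendsto (fun j ↦ ∫ s in (0 : ℝ)..T, a j s) atTop (𝓝 0) := by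
      simp only [hstrip]; exact hlim
    exact ge_of_tendsto hb (eventually_atTop.2 ⟨k, fun j hj ↦ (hEmono k j hj).trans (hEbound j)⟩)
  -- conclusion at `x₀`
  obtain ⟨k, hk⟩ := (hη1 x₀).exists
  have hk1 : η k x₀ = 1 := hk.self_of_nhds
  have hcont : Continuous fun x ↦ h k x • F s₀ x := (hhc k).smul (hFsc s₀ hs₀O)
  have hnn : 0 ≤ fun x ↦ h k x • F s₀ x := fun x ↦ mul_nonneg (hh0 k x) (hΦbd _).1
  have hae := (integral_eq_zero_iff_of_nonneg hnn (hEi k)).1 (hEzero k)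
  have heq := (hcont.ae_eq_iff_eq μ continuous_const).1 hae
  have hx : h k x₀ * F s₀ x₀ = 0 := congr_fun heq x₀
  have hpos : 0 < h k x₀ := by simp only [hh, hk1, one_mul]; exact Real.exp_pos _
  have hΦ0 : Φ (z s₀ x₀) = 0 := by
    rcases mul_eq_zero.1 hx with h0 | h0
    · exact absurd h0 hpos.ne'
    · exact h0
  exact hΦzero _ hΦ0

end MaxPrinciple

section TwoSided

variable {n : ℕ} {M : Type*} [TopologicalSpace M] [T2Space M] [SecondCountableTopology M]
  [ChartedSpace (EuclideanSpace ℝ (Fin n)) M] [IsManifold (𝓡 n) ∞ M] [T3Space M]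
  [MeasurableSpace M] [BorelSpace M]
  {g : PseudoRiemannianMetric (𝓡 n) ∞ (EuclideanSpace ℝ (Fin n)) (TangentSpace (𝓡 n) : M → Type _)}
  [g.HasLeviCivita]

/-- **Two-sided bounds `inf ρ₀ ≤ ρ ≤ sup ρ₀` along the weighted heat flow on a complete weighted
manifold** with weighted cut-offs (`IsWeightedCutoff g V η C`): for a solution
`ρ` of `∂ₛρ = Lρ` on `[0, T]` with `c₁ ≤ ρ(0) ≤ C₁`, `c₁ ≤ c₀ ≤ C₁`, `(ρ − c₀)² e^{-V}` integrable
on the strip and `e^{-V} ∈ L¹(M)`, both `z = ρ − C₁` and `z = c₁ − ρ` are (sub)solutions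
(`L(aρ + b) = aLρ`) with `z(0) ≤ 0` and `z₊ ≤ |ρ − c₀| ≤ (ρ − c₀)² + 1`, so
`z₊ e^{-V} ∈ L¹(M × (0,T))` and `z ≤ 0` by the weak maximum principle
`weightedMaxPrinciple`. The closed case is `heatFlow_ge_of_ge` / `heatFlow_le_of_le`
(`WeightedHeatFlowAPriori.lean`). [cite: Grigoryan2009, §11.4 and §12.1
(uniqueness class / maximum principle for the Cauchy problem on complete weighted manifolds)] -/
theorem IsWeightedHeatSolOn.twoSidedBound {V : M → ℝ} {ρ : ℝ → M → ℝ} {O : Set ℝ} {T : ℝ}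
    (hsol : IsWeightedHeatSolOn g V ρ O T) (hg : g.IsRiemannian) (hV : ContMDiff (𝓡 n) 𝓘(ℝ, ℝ) ∞ V)
    (hfin : Integrable (fun x ↦ Real.exp (-V x)) g.riemVolume)
    {η : ℕ → M → ℝ} {C : ℝ} (hη : IsWeightedCutoff g V η C) (hT : 0 < T)
    {c₀ c₁ C₁ : ℝ} (hc₁ : c₁ ≤ c₀) (hC₁ : c₀ ≤ C₁) (hρ0 : ∀ x, c₁ ≤ ρ 0 x ∧ ρ 0 x ≤ C₁)
    (hint : Integrable (fun p : M × ℝ ↦ (ρ p.2 p.1 - c₀) ^ 2 * Real.exp (-V p.1))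
      ((g.riemVolume.prod (volume : Measure ℝ)).restrict (univ ×ˢ Ioo 0 T)))
    {s : ℝ} (hs : s ∈ Icc 0 T) (x : M) : c₁ ≤ ρ s x ∧ ρ s x ≤ C₁ := by
  obtain ⟨hO, hTO, hρ, heq⟩ := hsol
  -- measure-theoretic preliminaries
  haveI : LocallyCompactSpace M := Manifold.locallyCompact_of_finiteDimensional (M := M) (𝓡 n)
  haveI : IsFiniteMeasureOnCompacts g.riemVolume :=
    CarrilloNi2009_shrinkerLSI.isFiniteMeasureOnCompacts_riemVolume hg
  haveI : IsLocallyFiniteMeasure g.riemVolume := isLocallyFiniteMeasure_of_isFiniteMeasureOnCompacts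
  set μ : Measure M := g.riemVolume with hμ
  set ν : Measure (M × ℝ) := (μ.prod (volume : Measure ℝ)).restrict (univ ×ˢ Ioo 0 T) with hν
  have hνeq : ν = μ.prod ((volume : Measure ℝ).restrict (Ioo 0 T)) := by
    rw [hν, ← Measure.prod_restrict, Measure.restrict_univ]
  have hexpc : Continuous fun y ↦ Real.exp (-V y) := Real.continuous_exp.comp hV.continuous.neg
  have hexp_strip : Integrable (fun p : M × ℝ ↦ Real.exp (-V p.1)) ν := by
    rw [hνeq]
    have h := hfin.mul_prod (integrable_const (1 : ℝ) :
      Integrable (fun _ : ℝ ↦ (1 : ℝ)) ((volume : Measure ℝ).restrict (Ioo 0 T)))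
    simpa using h
  have hbound : Integrable (fun p : M × ℝ ↦ (ρ p.2 p.1 - c₀) ^ 2 * Real.exp (-V p.1) +
      Real.exp (-V p.1)) ν := hint.add hexp_strip
  -- regularity of `ρ`
  have hρs : ∀ r ∈ O, ContMDiff (𝓡 n) 𝓘(ℝ, ℝ) ∞ (ρ r) := fun r hr ↦
    contMDiff_slice_of_contMDiffOn hρ hr
  have hρd : ∀ r ∈ O, ∀ y, HasDerivAt (fun r' ↦ ρ r' y) (deriv (fun r' ↦ ρ r' y) r) r := by
    intro r hr y
    have h := hasDerivWithinAt_time_of_contMDiffOn (I := 𝓡 n) (k := ∞) (by simp) hρ y hr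
    exact (h.hasDerivAt (hO.mem_nhds hr)).differentiableAt.hasDerivAt
  -- the maximum principle for the affine images `a ρ + b`
  have key : ∀ a b : ℝ, (∀ y, a * ρ 0 y + b ≤ 0) → (∀ r y, a * ρ r y + b ≤ |ρ r y - c₀|) →
      a * ρ s x + b ≤ 0 := by
    intro a b h0 hle
    set z : ℝ → M → ℝ := fun r y ↦ a * ρ r y + b with hz
    have hzs : ContMDiffOn ((𝓡 n).prod 𝓘(ℝ, ℝ)) 𝓘(ℝ, ℝ) ∞ (fun p : M × ℝ ↦ z p.2 p.1)
        (univ ×ˢ O) := (contMDiffOn_const.mul hρ).add contMDiffOn_const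
    have hsub : ∀ r ∈ Icc 0 T, ∀ y, deriv (fun r' ↦ z r' y) r ≤ g.dalembertian (z r) y -
        g.innerDual y (mvfderiv (𝓡 n) V y).toLinearMap (mvfderiv (𝓡 n) (z r) y).toLinearMap := by
      intro r hr y
      have hrO := hTO hr
      have hd : HasDerivAt (fun r' ↦ z r' y) (a * deriv (fun r' ↦ ρ r' y) r) r :=
        ((hρd r hrO y).const_mul a).add_const b
      have h2 : ContMDiffAt (𝓡 n) 𝓘(ℝ, ℝ) 2 (ρ r) y :=
        ((hρs r hrO).of_le (WithTop.coe_le_coe.mpr le_top)).contMDiffAt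
      have hLz := weightedLaplacian_affine (g := g) (V := V) h2 a b
      rw [hd.deriv, show z r = fun y' ↦ a * ρ r y' + b from rfl, hLz, heq r hr y]
    have hint' : Integrable (fun p : M × ℝ ↦ max (z p.2 p.1) 0 * Real.exp (-V p.1)) ν := by
      refine hbound.mono' ?_ (ae_of_all _ fun p ↦ ?_)
      · have hcont : ContinuousOn (fun p : M × ℝ ↦ max (z p.2 p.1) 0 * Real.exp (-V p.1))
            (univ ×ˢ O) :=
          (hzs.continuousOn.sup continuousOn_const).mul (hexpc.comp continuous_fst).continuousOn
        exact (hcont.mono (prod_mono le_rfl (Ioo_subset_Icc_self.trans hTO))).aestronglyMeasurable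
          (MeasurableSet.univ.prod measurableSet_Ioo)
      · have hex := Real.exp_pos (-V p.1)
        have h1 : max (z p.2 p.1) 0 ≤ |ρ p.2 p.1 - c₀| := max_le (hle _ _) (abs_nonneg _)
        have h2 : |ρ p.2 p.1 - c₀| ≤ (ρ p.2 p.1 - c₀) ^ 2 + 1 := by
          nlinarith [abs_nonneg (ρ p.2 p.1 - c₀), sq_abs (ρ p.2 p.1 - c₀)]
        rw [Real.norm_eq_abs, abs_of_nonneg (mul_nonneg (le_max_right _ _) hex.le)]
        nlinarith
    exact weightedMaxPrinciple hg hV hη hT hO hTO hzs hsub h0 hint' hs x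
  refine ⟨?_, ?_⟩
  · have h := key (-1) c₁ (fun y ↦ by linarith [(hρ0 y).1])
      (fun r y ↦ by linarith [neg_abs_le (ρ r y - c₀)])
    linarith
  · have h := key 1 (-C₁) (fun y ↦ by linarith [(hρ0 y).2])
      (fun r y ↦ by linarith [le_abs_self (ρ r y - c₀)])
    linarith

end TwoSided

section Mass

variable {n : ℕ} {M : Type*} [TopologicalSpace M] [T2Space M] [SecondCountableTopology M]
  [ChartedSpace (EuclideanSpace ℝ (Fin n)) M] [IsManifold (𝓡 n) ∞ M] [T3Space M]
  [MeasurableSpace M] [BorelSpace M]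
  {g : PseudoRiemannianMetric (𝓡 n) ∞ (EuclideanSpace ℝ (Fin n)) (TangentSpace (𝓡 n) : M → Type _)}
  [g.HasLeviCivita]

/-- **Cut-off mass is almost conserved**: for `V` smooth, `η ∈ C_c^∞`, `ρ` smooth on `M × O`
(`O ⊇ [0, T]` open) with `∂ₛρ = Lρ` and `|ρ| ≤ B` on `[0, T]`, and `|Lη| e^{-V}` integrable,
`|∫ ρ(s) η e^{-V} − ∫ ρ(0) η e^{-V}| ≤ (B ∫ |Lη| e^{-V}) s` for `s ∈ [0, T]`: the derivative of
`s ↦ ∫ ρ(s) η e^{-V}` is `∫ (Lρ) η e^{-V} = ∫ ρ (Lη) e^{-V}` (Leibniz rule,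
`integral_cutoff_mul_weightedLaplacian`), bounded by `B ∫ |Lη| e^{-V}`; mean value inequality.
[cite: CarrilloNi2009, §3 (3.1)–(3.2)] -/
theorem abs_integral_cutoff_sub_le (hg : g.IsRiemannian) {V : M → ℝ}
    (hV : ContMDiff (𝓡 n) 𝓘(ℝ, ℝ) ∞ V) {η : M → ℝ} (hη : ContMDiff (𝓡 n) 𝓘(ℝ, ℝ) ∞ η)
    (hηc : HasCompactSupport η) {T : ℝ} {O : Set ℝ} {ρ : ℝ → M → ℝ} (hO : IsOpen O)
    (hTO : Icc 0 T ⊆ O)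
    (hρ : ContMDiffOn ((𝓡 n).prod 𝓘(ℝ, ℝ)) 𝓘(ℝ, ℝ) ∞ (fun p : M × ℝ ↦ ρ p.2 p.1) (univ ×ˢ O))
    (heq : ∀ s ∈ Icc 0 T, ∀ x, deriv (fun r ↦ ρ r x) s = g.dalembertian (ρ s) x
      - g.innerDual x (mvfderiv (𝓡 n) V x).toLinearMap (mvfderiv (𝓡 n) (ρ s) x).toLinearMap)
    {B : ℝ} (hB : ∀ s ∈ Icc 0 T, ∀ x, |ρ s x| ≤ B)
    (hLi : Integrable (fun x ↦ |g.dalembertian η x - g.innerDual x (mvfderiv (𝓡 n) V x).toLinearMap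
      (mvfderiv (𝓡 n) η x).toLinearMap| * Real.exp (-V x)) g.riemVolume)
    {s : ℝ} (hs : s ∈ Icc 0 T) :
    |(∫ x, ρ s x * (η x * Real.exp (-V x)) ∂g.riemVolume)
        - ∫ x, ρ 0 x * (η x * Real.exp (-V x)) ∂g.riemVolume| ≤
      (B * ∫ x, |g.dalembertian η x - g.innerDual x (mvfderiv (𝓡 n) V x).toLinearMap
        (mvfderiv (𝓡 n) η x).toLinearMap| * Real.exp (-V x) ∂g.riemVolume) * s := by
  haveI := CarrilloNi2009_shrinkerLSI.isFiniteMeasureOnCompacts_riemVolume hg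
  set μ : Measure M := g.riemVolume with hμ
  set Lη : M → ℝ := fun x ↦ g.dalembertian η x
    - g.innerDual x (mvfderiv (𝓡 n) V x).toLinearMap (mvfderiv (𝓡 n) η x).toLinearMap with hLη
  have hec : Continuous fun x ↦ Real.exp (-V x) := Real.continuous_exp.comp hV.continuous.neg
  have hw : Continuous fun x ↦ η x * Real.exp (-V x) := hη.continuous.mul hec
  have hwc : HasCompactSupport fun x ↦ η x * Real.exp (-V x) := hηc.mul_right
  have hslice : ∀ r ∈ O, ContMDiff (𝓡 n) 𝓘(ℝ, ℝ) ∞ (ρ r) := fun r hr ↦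
    contMDiff_slice_of_contMDiffOn hρ hr
  have hρc : ContinuousOn (fun p : M × ℝ ↦ ρ p.2 p.1) (univ ×ˢ O) := hρ.continuousOn
  have hρ'c : ContinuousOn (fun p : M × ℝ ↦ deriv (fun r ↦ ρ r p.1) p.2) (univ ×ˢ O) :=
    continuousOn_deriv_time_of_contMDiffOn hO hρ
  -- the cut-off mass and its derivative
  set Fk : ℝ → ℝ := fun r ↦ ∫ x, ρ r x * (η x * Real.exp (-V x)) ∂μ with hFk
  set Dk : ℝ → ℝ := fun r ↦ ∫ x, deriv (fun r' ↦ ρ r' x) r * (η x * Real.exp (-V x)) ∂μ with hDk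
  have hderiv : ∀ r ∈ O, HasDerivAt Fk (Dk r) r := fun r hr ↦
    hasDerivAt_integral_mul_of_hasCompactSupport μ hw hwc hO hρc hρ'c
      (fun r hr x ↦ hasDerivAt_time_of_contMDiffOn hO hρ x hr) hr
  -- on `[0, T]` the derivative is `∫ ρ (Lη) e^{-V}`
  have hDk : ∀ r ∈ Icc 0 T, Dk r = ∫ x, ρ r x * Lη x * Real.exp (-V x) ∂μ := by
    intro r hr
    have e1 : Dk r = ∫ x, η x * (g.dalembertian (ρ r) x - g.innerDual x
        (mvfderiv (𝓡 n) V x).toLinearMap (mvfderiv (𝓡 n) (ρ r) x).toLinearMap) *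
          Real.exp (-V x) ∂μ := by
      refine integral_congr_ae (Eventually.of_forall fun x ↦ ?_)
      simp only [heq r hr x]
      ring
    rw [e1, integral_cutoff_mul_weightedLaplacian_comm hg (hslice r (hTO hr)) hη hηc hV]
  -- and it is bounded by `B ∫ |Lη| e^{-V}`
  have hbound : ∀ r ∈ Ico (0 : ℝ) T, ‖Dk r‖ ≤ B * ∫ x, |Lη x| * Real.exp (-V x) ∂μ := by
    intro r hr
    have hr' : r ∈ Icc 0 T := Ico_subset_Icc_self hr
    rw [hDk r hr', Real.norm_eq_abs]
    calc |∫ x, ρ r x * Lη x * Real.exp (-V x) ∂μ|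
        ≤ ∫ x, |ρ r x * Lη x * Real.exp (-V x)| ∂μ := abs_integral_le_integral_abs
      _ ≤ ∫ x, B * (|Lη x| * Real.exp (-V x)) ∂μ := by
          refine integral_mono_of_nonneg (Eventually.of_forall fun x ↦ abs_nonneg _)
            (hLi.const_mul B) (Eventually.of_forall fun x ↦ ?_)
          show |ρ r x * Lη x * Real.exp (-V x)| ≤ B * (|Lη x| * Real.exp (-V x))
          rw [abs_mul, abs_mul, abs_of_nonneg (Real.exp_nonneg _)]
          calc |ρ r x| * |Lη x| * Real.exp (-V x) = |ρ r x| * (|Lη x| * Real.exp (-V x)) := by ring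
            _ ≤ B * (|Lη x| * Real.exp (-V x)) :=
              mul_le_mul_of_nonneg_right (hB r hr' x)
                (mul_nonneg (abs_nonneg _) (Real.exp_nonneg _))
      _ = B * ∫ x, |Lη x| * Real.exp (-V x) ∂μ := integral_const_mul _ _
  -- mean value inequality on `[0, s] ⊆ [0, T]`
  have hmv := norm_image_sub_le_of_norm_deriv_le_segment' (f := Fk)
    (fun r hr ↦ (hderiv r (hTO hr)).hasDerivWithinAt) hbound s hs
  rw [sub_zero, Real.norm_eq_abs] at hmv
  exact hmv

/-- **Conservation of mass for the weighted heat flow on a complete manifold**: with `e^{-V} ∈ L¹`,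
weighted cut-offs (`IsWeightedCutoff g V η C`), and a
bounded solution `ρ` of `∂ₛρ = Lρ` on `[0, T]`, `∫ ρ(s) e^{-V} dV = ∫ ρ(0) e^{-V} dV` for
`s ∈ [0, T]`: `abs_integral_cutoff_sub_le` with `η = η_k`, `∫ |Lη_k| e^{-V} → 0` and
`∫ ρ(s) η_k e^{-V} → ∫ ρ(s) e^{-V}` by dominated convergence. [cite: CarrilloNi2009, §3 (3.1)–(3.2)] -/
theorem IsWeightedHeatSolOn.integral_mul_exp_neg_eq {V : M → ℝ} {ρ : ℝ → M → ℝ} {O : Set ℝ} {T : ℝ}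
    (hsol : IsWeightedHeatSolOn g V ρ O T) (hg : g.IsRiemannian) (hV : ContMDiff (𝓡 n) 𝓘(ℝ, ℝ) ∞ V)
    (hVint : Integrable (fun x ↦ Real.exp (-V x)) g.riemVolume)
    {η : ℕ → M → ℝ} {C : ℝ} (hη : IsWeightedCutoff g V η C) (hT : 0 < T)
    {B : ℝ} (hB : ∀ s ∈ Icc 0 T, ∀ x, |ρ s x| ≤ B) {s : ℝ} (hs : s ∈ Icc 0 T) :
    ∫ x, ρ s x * Real.exp (-V x) ∂g.riemVolume = ∫ x, ρ 0 x * Real.exp (-V x) ∂g.riemVolume := by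
  obtain ⟨hO, hTO, hρ, heq⟩ := hsol
  obtain ⟨⟨hηs, hηc, hη01, _, hη1⟩, hLη⟩ := id hη
  haveI := CarrilloNi2009_shrinkerLSI.isFiniteMeasureOnCompacts_riemVolume hg
  have h1 : (1 : ℕ∞ω) ≤ (∞ : ℕ∞ω) := WithTop.coe_le_coe.mpr le_top
  have h2 : (2 : ℕ∞ω) ≤ (∞ : ℕ∞ω) := WithTop.coe_le_coe.mpr le_top
  set μ : Measure M := g.riemVolume with hμ
  set L : ℕ → M → ℝ := fun k x ↦ g.dalembertian (η k) x
    - g.innerDual x (mvfderiv (𝓡 n) V x).toLinearMap (mvfderiv (𝓡 n) (η k) x).toLinearMap with hL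
  have hec : Continuous fun x ↦ Real.exp (-V x) := Real.continuous_exp.comp hV.continuous.neg
  have hLc : ∀ k, Continuous (L k) := fun k ↦
    (continuous_dalembertian g ((hηs k).of_le h2)).sub
      (continuous_innerDual_mvfderiv g (hV.of_le h1) ((hηs k).of_le h1))
  have hslice : ∀ r ∈ O, ContMDiff (𝓡 n) 𝓘(ℝ, ℝ) ∞ (ρ r) := fun r hr ↦
    contMDiff_slice_of_contMDiffOn hρ hr
  have h0T : (0 : ℝ) ∈ Icc 0 T := ⟨le_rfl, hT.le⟩
  -- `|Lη_k| e^{-V}` is dominated by `C e^{-V}` and tends to `0`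
  have hLbd : ∀ k x, ‖|L k x| * Real.exp (-V x)‖ ≤ C * Real.exp (-V x) := fun k x ↦ by
    rw [Real.norm_eq_abs, abs_mul, abs_abs, abs_of_nonneg (Real.exp_nonneg _)]
    exact mul_le_mul_of_nonneg_right (hLη k x) (Real.exp_nonneg _)
  have hLm : ∀ k, AEStronglyMeasurable (fun x ↦ |L k x| * Real.exp (-V x)) μ := fun k ↦
    ((continuous_abs.comp (hLc k)).mul hec).aestronglyMeasurable
  have hLi : ∀ k, Integrable (fun x ↦ |L k x| * Real.exp (-V x)) μ := fun k ↦
    (hVint.const_mul C).mono' (hLm k) (Eventually.of_forall (hLbd k))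
  have hLt : Tendsto (fun k ↦ ∫ x, |L k x| * Real.exp (-V x) ∂μ) atTop (𝓝 0) := by
    have hlim : ∀ x, Tendsto (fun k ↦ |L k x| * Real.exp (-V x)) atTop (𝓝 0) := fun x ↦ by
      refine tendsto_const_nhds.congr' ?_
      filter_upwards [hη.toIsCutoffExhaustion.weightedLaplacian_eventually_eq_zero V x] with k hk
      rw [show L k x = 0 from hk, abs_zero, zero_mul]
    have h := tendsto_integral_of_dominated_convergence (fun x ↦ C * Real.exp (-V x)) hLm
      (hVint.const_mul C) (fun k ↦ Eventually.of_forall (hLbd k)) (Eventually.of_forall hlim)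
    simpa using h
  -- Step 1: `|F_k(s) - F_k(0)| ≤ (B ∫ |Lη_k| e^{-V}) s`
  have hstep : ∀ k, |(∫ x, ρ s x * (η k x * Real.exp (-V x)) ∂μ)
      - ∫ x, ρ 0 x * (η k x * Real.exp (-V x)) ∂μ| ≤
        (B * ∫ x, |L k x| * Real.exp (-V x) ∂μ) * s := fun k ↦
    abs_integral_cutoff_sub_le hg hV (hηs k) (hηc k) hO hTO hρ heq hB (hLi k) hs
  -- Step 2: `F_k(r) → ∫ ρ(r) e^{-V}` for `r ∈ [0, T]`
  have hconv : ∀ r ∈ Icc 0 T, Tendsto (fun k ↦ ∫ x, ρ r x * (η k x * Real.exp (-V x)) ∂μ) atTop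
      (𝓝 (∫ x, ρ r x * Real.exp (-V x) ∂μ)) := by
    intro r hr
    refine tendsto_integral_of_dominated_convergence (fun x ↦ B * Real.exp (-V x))
      (fun k ↦ ((hslice r (hTO hr)).continuous.mul ((hηs k).continuous.mul hec)).aestronglyMeasurable)
      (hVint.const_mul B) (fun k ↦ Eventually.of_forall fun x ↦ ?_) (Eventually.of_forall fun x ↦ ?_)
    · rw [Real.norm_eq_abs, abs_mul, abs_mul, abs_of_nonneg (hη01 k x).1,
        abs_of_nonneg (Real.exp_nonneg _)]
      calc |ρ r x| * (η k x * Real.exp (-V x)) ≤ |ρ r x| * Real.exp (-V x) :=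
            mul_le_mul_of_nonneg_left (mul_le_of_le_one_left (Real.exp_nonneg _) (hη01 k x).2)
              (abs_nonneg _)
        _ ≤ B * Real.exp (-V x) := mul_le_mul_of_nonneg_right (hB r hr x) (Real.exp_nonneg _)
    · simpa using ((hη.toIsCutoffExhaustion.tendsto_one x).mul_const (Real.exp (-V x))).const_mul (ρ r x)
  -- Step 3: the limit of `F_k(s) - F_k(0)` is both `∫ ρ(s) e^{-V} - ∫ ρ(0) e^{-V}` and `0`
  have ha : Tendsto (fun k ↦ (∫ x, ρ s x * (η k x * Real.exp (-V x)) ∂μ)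
      - ∫ x, ρ 0 x * (η k x * Real.exp (-V x)) ∂μ) atTop
      (𝓝 ((∫ x, ρ s x * Real.exp (-V x) ∂μ) - ∫ x, ρ 0 x * Real.exp (-V x) ∂μ)) :=
    (hconv s hs).sub (hconv 0 h0T)
  have ha0 : Tendsto (fun k ↦ (∫ x, ρ s x * (η k x * Real.exp (-V x)) ∂μ)
      - ∫ x, ρ 0 x * (η k x * Real.exp (-V x)) ∂μ) atTop (𝓝 0) := by
    refine squeeze_zero_norm (a := fun k ↦ (B * ∫ x, |L k x| * Real.exp (-V x) ∂μ) * s)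
      (fun k ↦ ?_) ?_
    · rw [Real.norm_eq_abs]
      exact hstep k
    · simpa using (hLt.const_mul B).mul_const s
  exact sub_eq_zero.mp (tendsto_nhds_unique ha ha0)

end Mass

section Energy

variable {n : ℕ} {M : Type*} [TopologicalSpace M] [T2Space M] [SecondCountableTopology M]
  [ChartedSpace (EuclideanSpace ℝ (Fin n)) M] [IsManifold (𝓡 n) ∞ M] [T3Space M]
  [MeasurableSpace M] [BorelSpace M]
  {g : PseudoRiemannianMetric (𝓡 n) ∞ (EuclideanSpace ℝ (Fin n)) (TangentSpace (𝓡 n) : M → Type _)}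
  [g.HasLeviCivita]

/-- **The integrated energy identity with one cut-off.** For `V` smooth, `η ∈ C_c^∞`, `ρ` smooth on
`M × O` (`O ⊇ [0, T]` open) with `∂ₛρ = Lρ` on `[0, T]`, and a constant `c₀`,
`2 ∫∫_{M×(0,T)} |∇ρ|² η e^{-V} = E(0) − E(T) + ∫∫_{M×(0,T)} (ρ − c₀)² (Lη) e^{-V}`,
`E(s) = ∫ (ρ(s) − c₀)² η e^{-V} dV`: `E' = 2∫ (ρ − c₀)(Lρ) η e^{-V} = −2∫ η|∇ρ|² e^{-V} + ∫ (ρ − c₀)²(Lη)e^{-V}`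
(Leibniz rule, `integral_sub_mul_cutoff_mul_weightedLaplacian`), integrated over `[0, T]` (FTC,
Fubini). [cite: CarrilloNi2009, §4 (integration by parts on the complete soliton)] -/
theorem two_mul_integral_gradSq_cutoff_eq (hg : g.IsRiemannian) {V : M → ℝ}
    (hV : ContMDiff (𝓡 n) 𝓘(ℝ, ℝ) ∞ V) {η : M → ℝ} (hη : ContMDiff (𝓡 n) 𝓘(ℝ, ℝ) ∞ η)
    (hηc : HasCompactSupport η) {T : ℝ} {O : Set ℝ} {ρ : ℝ → M → ℝ} (hT : 0 < T) (hO : IsOpen O)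
    (hTO : Icc 0 T ⊆ O)
    (hρ : ContMDiffOn ((𝓡 n).prod 𝓘(ℝ, ℝ)) 𝓘(ℝ, ℝ) ∞ (fun p : M × ℝ ↦ ρ p.2 p.1) (univ ×ˢ O))
    (heq : ∀ s ∈ Icc 0 T, ∀ x, deriv (fun r ↦ ρ r x) s = g.dalembertian (ρ s) x
      - g.innerDual x (mvfderiv (𝓡 n) V x).toLinearMap (mvfderiv (𝓡 n) (ρ s) x).toLinearMap)
    (c₀ : ℝ) :
    2 * ∫ p, g.gradSq (ρ p.2) p.1 * (η p.1 * Real.exp (-V p.1))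
        ∂(g.riemVolume.prod (volume : Measure ℝ)).restrict (univ ×ˢ Ioo 0 T) =
      ∫ x, (ρ 0 x - c₀) ^ 2 * (η x * Real.exp (-V x)) ∂g.riemVolume
        - ∫ x, (ρ T x - c₀) ^ 2 * (η x * Real.exp (-V x)) ∂g.riemVolume
        + ∫ p, (ρ p.2 p.1 - c₀) ^ 2 * ((g.dalembertian η p.1 - g.innerDual p.1
            (mvfderiv (𝓡 n) V p.1).toLinearMap (mvfderiv (𝓡 n) η p.1).toLinearMap) *
              Real.exp (-V p.1)) ∂(g.riemVolume.prod (volume : Measure ℝ)).restrict (univ ×ˢ Ioo 0 T) := by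
  haveI := CarrilloNi2009_shrinkerLSI.isFiniteMeasureOnCompacts_riemVolume hg
  haveI := sigmaFinite_riemVolume hg
  have h01 : (0 : ℝ) ≤ T := hT.le
  have h1 : (1 : ℕ∞ω) ≤ (∞ : ℕ∞ω) := WithTop.coe_le_coe.mpr le_top
  have h2 : (2 : ℕ∞ω) ≤ (∞ : ℕ∞ω) := WithTop.coe_le_coe.mpr le_top
  set μ : Measure M := g.riemVolume with hμ
  -- the two compactly supported weights `η e^{-V}` and `(Lη) e^{-V}`
  set Lη : M → ℝ := fun x ↦ g.dalembertian η x
    - g.innerDual x (mvfderiv (𝓡 n) V x).toLinearMap (mvfderiv (𝓡 n) η x).toLinearMap with hLη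
  have hec : Continuous fun x ↦ Real.exp (-V x) := Real.continuous_exp.comp hV.continuous.neg
  have hwE : Continuous fun x ↦ η x * Real.exp (-V x) := hη.continuous.mul hec
  have hwEc : HasCompactSupport fun x ↦ η x * Real.exp (-V x) := hηc.mul_right
  have hLηc : Continuous Lη :=
    (continuous_dalembertian g (hη.of_le h2)).sub
      (continuous_innerDual_mvfderiv g (hV.of_le h1) (hη.of_le h1))
  have hLηs : HasCompactSupport Lη := by
    refine HasCompactSupport.intro hηc fun x hx ↦ ?_
    simp only [hLη]
    rw [g.dalembertian_eq_zero_of_notMem_tsupport hx, mvfderiv_eq_zero_of_notMem_tsupport hx]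
    simp [PseudoRiemannianMetric.innerDual]
  have hwR : Continuous fun x ↦ Lη x * Real.exp (-V x) := hLηc.mul hec
  have hwRc : HasCompactSupport fun x ↦ Lη x * Real.exp (-V x) := hLηs.mul_right
  -- slices and time derivatives of `ρ`
  have hslice : ∀ s ∈ O, ContMDiff (𝓡 n) 𝓘(ℝ, ℝ) ∞ (ρ s) := fun s hs ↦
    contMDiff_slice_of_contMDiffOn hρ hs
  have hρc : ContinuousOn (fun p : M × ℝ ↦ ρ p.2 p.1) (univ ×ˢ O) := hρ.continuousOn
  have hρ'c : ContinuousOn (fun p : M × ℝ ↦ deriv (fun r ↦ ρ r p.1) p.2) (univ ×ˢ O) :=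
    continuousOn_deriv_time_of_contMDiffOn hO hρ
  have hF : ContinuousOn (fun p : M × ℝ ↦ (ρ p.2 p.1 - c₀) ^ 2) (univ ×ˢ O) :=
    (hρc.sub continuousOn_const).pow 2
  have hF' : ContinuousOn (fun p : M × ℝ ↦ 2 * (ρ p.2 p.1 - c₀) * deriv (fun r ↦ ρ r p.1) p.2)
      (univ ×ˢ O) := (continuousOn_const.mul (hρc.sub continuousOn_const)).mul hρ'c
  have hd : ∀ s ∈ O, ∀ x, HasDerivAt (fun r ↦ (ρ r x - c₀) ^ 2)
      (2 * (ρ s x - c₀) * deriv (fun r ↦ ρ r x) s) s := by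
    intro s hs x
    have h := ((hasDerivAt_time_of_contMDiffOn hO hρ x hs).sub_const c₀).pow 2
    refine h.congr_deriv ?_
    norm_num
  have hgradc : ContinuousOn (fun p : M × ℝ ↦ g.gradSq (ρ p.2) p.1) (univ ×ˢ O) :=
    (contMDiffOn_gradSq_family g hO.uniqueDiffOn hρ).continuousOn
  -- the energy `E`, its derivative `E'`, the gradient term `G` and the error term `R`
  set E : ℝ → ℝ := fun s ↦ ∫ x, (ρ s x - c₀) ^ 2 * (η x * Real.exp (-V x)) ∂μ with hE
  set E' : ℝ → ℝ := fun s ↦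
    ∫ x, (2 * (ρ s x - c₀) * deriv (fun r ↦ ρ r x) s) * (η x * Real.exp (-V x)) ∂μ with hE'
  set G : ℝ → ℝ := fun s ↦ ∫ x, g.gradSq (ρ s) x * (η x * Real.exp (-V x)) ∂μ with hG
  set R : ℝ → ℝ := fun s ↦ ∫ x, (ρ s x - c₀) ^ 2 * (Lη x * Real.exp (-V x)) ∂μ with hR
  have hEd : ∀ s ∈ O, HasDerivAt E (E' s) s := fun s hs ↦
    hasDerivAt_integral_mul_of_hasCompactSupport μ hwE hwEc hO hF hF' hd hs
  have hE'c : ContinuousOn E' O := continuousOn_integral_mul_of_hasCompactSupport μ hwE hwEc hF'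
  have hGc : ContinuousOn G O := continuousOn_integral_mul_of_hasCompactSupport μ hwE hwEc hgradc
  have hRc : ContinuousOn R O := continuousOn_integral_mul_of_hasCompactSupport μ hwR hwRc hF
  -- `E' = -2 G + R` on `[0, T]` (the equation and the energy identity with a cut-off)
  have hE'eq : ∀ s ∈ Icc 0 T, E' s = -2 * G s + R s := by
    intro s hs
    have hsO := hTO hs
    have hid := integral_sub_mul_cutoff_mul_weightedLaplacian hg (hslice s hsO) hη hηc hV c₀
    have e0 : E' s = 2 * ∫ x, (ρ s x - c₀) * η x * (g.dalembertian (ρ s) x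
        - g.innerDual x (mvfderiv (𝓡 n) V x).toLinearMap (mvfderiv (𝓡 n) (ρ s) x).toLinearMap) *
          Real.exp (-V x) ∂μ := by
      rw [hE', ← integral_const_mul]
      refine integral_congr_ae (Eventually.of_forall fun x ↦ ?_)
      simp only [heq s hs x]
      ring
    have e1 : ∫ x, η x * g.gradSq (ρ s) x * Real.exp (-V x) ∂μ = G s :=
      integral_congr_ae (Eventually.of_forall fun x ↦ by ring)
    have e2 : ∫ x, (ρ s x - c₀) ^ 2 * (g.dalembertian η x
        - g.innerDual x (mvfderiv (𝓡 n) V x).toLinearMap (mvfderiv (𝓡 n) η x).toLinearMap) *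
          Real.exp (-V x) ∂μ = R s :=
      integral_congr_ae (Eventually.of_forall fun x ↦ by simp only [hLη]; ring)
    rw [e0, hid, e1, e2]
    ring
  -- the fundamental theorem of calculus on `[0, T]`
  have huIcc : uIcc (0 : ℝ) T = Icc 0 T := uIcc_of_le h01
  have hFTC : ∫ s in (0 : ℝ)..T, E' s = E T - E 0 :=
    intervalIntegral.integral_eq_sub_of_hasDerivAt (fun s hs ↦ hEd s (hTO (huIcc ▸ hs)))
      ((hE'c.mono hTO).intervalIntegrable_of_Icc h01)
  have hGi : IntervalIntegrable G volume 0 T := (hGc.mono hTO).intervalIntegrable_of_Icc h01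
  have hRi : IntervalIntegrable R volume 0 T := (hRc.mono hTO).intervalIntegrable_of_Icc h01
  have hsplit : ∫ s in (0 : ℝ)..T, E' s =
      -2 * (∫ s in (0 : ℝ)..T, G s) + ∫ s in (0 : ℝ)..T, R s := by
    have e1 : ∫ s in (0 : ℝ)..T, E' s = ∫ s in (0 : ℝ)..T, (-2 * G s + R s) :=
      intervalIntegral.integral_congr fun s hs ↦ hE'eq s (huIcc ▸ hs)
    have e2 : ∫ s in (0 : ℝ)..T, (-2 * G s + R s) =
        (∫ s in (0 : ℝ)..T, -2 * G s) + ∫ s in (0 : ℝ)..T, R s :=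
      intervalIntegral.integral_add (hGi.const_mul (-2)) hRi
    have e3 : ∫ s in (0 : ℝ)..T, -2 * G s = -2 * ∫ s in (0 : ℝ)..T, G s :=
      intervalIntegral.integral_const_mul _ _
    rw [e1, e2, e3]
  -- Fubini on the strip for `G` and `R`
  have hGF : ∫ p, g.gradSq (ρ p.2) p.1 * (η p.1 * Real.exp (-V p.1))
      ∂(μ.prod (volume : Measure ℝ)).restrict (univ ×ˢ Ioo 0 T) = ∫ s in (0 : ℝ)..T, G s :=
    integral_strip_eq_intervalIntegral μ h01
      (integrable_strip_mul_of_hasCompactSupport μ (hgradc.mono (prod_mono le_rfl hTO)) hwE hwEc)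
  have hRF : ∫ p, (ρ p.2 p.1 - c₀) ^ 2 * (Lη p.1 * Real.exp (-V p.1))
      ∂(μ.prod (volume : Measure ℝ)).restrict (univ ×ˢ Ioo 0 T) = ∫ s in (0 : ℝ)..T, R s :=
    integral_strip_eq_intervalIntegral μ h01
      (integrable_strip_mul_of_hasCompactSupport μ (hF.mono (prod_mono le_rfl hTO)) hwR hwRc)
  have eE0 : E 0 = ∫ x, (ρ 0 x - c₀) ^ 2 * (η x * Real.exp (-V x)) ∂μ := rfl
  have eET : E T = ∫ x, (ρ T x - c₀) ^ 2 * (η x * Real.exp (-V x)) ∂μ := rfl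
  rw [hGF, hRF]
  linarith [hFTC, hsplit, eE0, eET]

/-- **The energy estimate for the weighted heat flow on a complete manifold**: with weighted cut-offs
(`IsWeightedCutoff g V η C`), a solution
`ρ` of `∂ₛρ = Lρ` on `[0, T]` (smooth on `M × O`, `O ⊇ [0, T]` open) with `(ρ − c₀)² e^{-V}`
integrable on the strip `M × (0, T)` and at `s = 0` has `|∇ρ|² e^{-V}` integrable on the strip and
`∫∫_{M×(0,T)} |∇ρ|² e^{-V} ≤ ½ ∫ (ρ(0) − c₀)² e^{-V}`. Proof: `two_mul_integral_gradSq_cutoff_eq`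
with `η = η_k`; `E_k(T) ≥ 0`, `E_k(0) ≤ ∫ (ρ₀ − c₀)² e^{-V}`; the error term tends to `0` by
dominated convergence (`|Lη_k| ≤ C`, `Lη_k(x) = 0` for large `k`); `k → ∞` by Fatou and
dominated convergence (`η_k ↑ 1`). [cite: CarrilloNi2009, §4 (integration by parts on the complete soliton)] -/
theorem IsWeightedHeatSolOn.integrable_gradSq_strip {V : M → ℝ} {ρ : ℝ → M → ℝ} {O : Set ℝ} {T : ℝ}
    (hsol : IsWeightedHeatSolOn g V ρ O T) (hg : g.IsRiemannian) (hV : ContMDiff (𝓡 n) 𝓘(ℝ, ℝ) ∞ V)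
    {η : ℕ → M → ℝ} {C : ℝ} (hη : IsWeightedCutoff g V η C) (hT : 0 < T) (c₀ : ℝ)
    (hInt : Integrable (fun p : M × ℝ ↦ (ρ p.2 p.1 - c₀) ^ 2 * Real.exp (-V p.1))
      ((g.riemVolume.prod (volume : Measure ℝ)).restrict (univ ×ˢ Ioo 0 T)))
    (h0 : Integrable (fun x ↦ (ρ 0 x - c₀) ^ 2 * Real.exp (-V x)) g.riemVolume) :
    Integrable (fun p : M × ℝ ↦ g.gradSq (ρ p.2) p.1 * Real.exp (-V p.1))
        ((g.riemVolume.prod (volume : Measure ℝ)).restrict (univ ×ˢ Ioo 0 T)) ∧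
      ∫ p in univ ×ˢ Ioo 0 T, g.gradSq (ρ p.2) p.1 * Real.exp (-V p.1)
          ∂(g.riemVolume.prod (volume : Measure ℝ)) ≤
        1 / 2 * ∫ x, (ρ 0 x - c₀) ^ 2 * Real.exp (-V x) ∂g.riemVolume := by
  obtain ⟨hO, hTO, hρ, heq⟩ := hsol
  obtain ⟨⟨hηs, hηc, hη01, _, hη1⟩, hLη⟩ := id hη
  haveI := CarrilloNi2009_shrinkerLSI.isFiniteMeasureOnCompacts_riemVolume hg
  haveI := sigmaFinite_riemVolume hg
  have h1 : (1 : ℕ∞ω) ≤ (∞ : ℕ∞ω) := WithTop.coe_le_coe.mpr le_top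
  have h2 : (2 : ℕ∞ω) ≤ (∞ : ℕ∞ω) := WithTop.coe_le_coe.mpr le_top
  set μ : Measure M := g.riemVolume with hμ
  set ν : Measure (M × ℝ) := (μ.prod (volume : Measure ℝ)).restrict (univ ×ˢ Ioo 0 T) with hν
  set L : ℕ → M → ℝ := fun k x ↦ g.dalembertian (η k) x
    - g.innerDual x (mvfderiv (𝓡 n) V x).toLinearMap (mvfderiv (𝓡 n) (η k) x).toLinearMap with hL
  set A : ℝ := ∫ x, (ρ 0 x - c₀) ^ 2 * Real.exp (-V x) ∂μ with hA
  set B : ℝ := ∫ p, (ρ p.2 p.1 - c₀) ^ 2 * Real.exp (-V p.1) ∂ν with hB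
  set r : ℕ → ℝ := fun k ↦ ∫ p, (ρ p.2 p.1 - c₀) ^ 2 * (L k p.1 * Real.exp (-V p.1)) ∂ν with hr
  set F : M × ℝ → ℝ := fun p ↦ g.gradSq (ρ p.2) p.1 * Real.exp (-V p.1) with hFdef
  have hec : Continuous fun x ↦ Real.exp (-V x) := Real.continuous_exp.comp hV.continuous.neg
  -- Step 1: the integrated identity for every `k`
  have hid : ∀ k, 2 * ∫ p, g.gradSq (ρ p.2) p.1 * (η k p.1 * Real.exp (-V p.1)) ∂ν =
      ∫ x, (ρ 0 x - c₀) ^ 2 * (η k x * Real.exp (-V x)) ∂μ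
        - ∫ x, (ρ T x - c₀) ^ 2 * (η k x * Real.exp (-V x)) ∂μ + r k := fun k ↦
    two_mul_integral_gradSq_cutoff_eq hg hV (hηs k) (hηc k) hT hO hTO hρ heq c₀
  -- Step 2: `E_k(0) ≤ A`, `E_k(T) ≥ 0`
  have hE0 : ∀ k, ∫ x, (ρ 0 x - c₀) ^ 2 * (η k x * Real.exp (-V x)) ∂μ ≤ A := fun k ↦ by
    refine integral_mono_of_nonneg (Eventually.of_forall fun x ↦ ?_) h0
      (Eventually.of_forall fun x ↦ ?_)
    · exact mul_nonneg (sq_nonneg _) (mul_nonneg (hη01 k x).1 (Real.exp_nonneg _))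
    · exact mul_le_mul_of_nonneg_left (mul_le_of_le_one_left (Real.exp_nonneg _) (hη01 k x).2)
        (sq_nonneg _)
  have hET : ∀ k, 0 ≤ ∫ x, (ρ T x - c₀) ^ 2 * (η k x * Real.exp (-V x)) ∂μ := fun k ↦
    integral_nonneg fun x ↦ mul_nonneg (sq_nonneg _) (mul_nonneg (hη01 k x).1 (Real.exp_nonneg _))
  -- Step 3: the error terms `r k` are dominated by `C (ρ - c₀)² e^{-V}` and tend to `0`
  have hcontρ : ContinuousOn (fun p : M × ℝ ↦ ρ p.2 p.1) (univ ×ˢ Ioo 0 T) :=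
    hρ.continuousOn.mono (prod_mono le_rfl (Ioo_subset_Icc_self.trans hTO))
  have hLc : ∀ k, Continuous (L k) := fun k ↦
    (continuous_dalembertian g ((hηs k).of_le h2)).sub
      (continuous_innerDual_mvfderiv g (hV.of_le h1) ((hηs k).of_le h1))
  have hr_meas : ∀ k, AEStronglyMeasurable
      (fun p : M × ℝ ↦ (ρ p.2 p.1 - c₀) ^ 2 * (L k p.1 * Real.exp (-V p.1))) ν := fun k ↦
    aestronglyMeasurable_strip μ (((hcontρ.sub continuousOn_const).pow 2).mul
      (((hLc k).comp continuous_fst).mul (hec.comp continuous_fst)).continuousOn)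
  have hr_bound : ∀ k (p : M × ℝ), ‖(ρ p.2 p.1 - c₀) ^ 2 * (L k p.1 * Real.exp (-V p.1))‖ ≤
      C * ((ρ p.2 p.1 - c₀) ^ 2 * Real.exp (-V p.1)) := fun k p ↦ by
    rw [Real.norm_eq_abs, abs_mul, abs_mul, abs_of_nonneg (sq_nonneg _),
      abs_of_nonneg (Real.exp_nonneg _)]
    have hC := hLη k p.1
    have h0' : 0 ≤ (ρ p.2 p.1 - c₀) ^ 2 * Real.exp (-V p.1) :=
      mul_nonneg (sq_nonneg _) (Real.exp_nonneg _)
    calc (ρ p.2 p.1 - c₀) ^ 2 * (|L k p.1| * Real.exp (-V p.1))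
        = |L k p.1| * ((ρ p.2 p.1 - c₀) ^ 2 * Real.exp (-V p.1)) := by ring
      _ ≤ C * ((ρ p.2 p.1 - c₀) ^ 2 * Real.exp (-V p.1)) := mul_le_mul_of_nonneg_right hC h0'
  have hdom : Integrable (fun p : M × ℝ ↦ C * ((ρ p.2 p.1 - c₀) ^ 2 * Real.exp (-V p.1))) ν :=
    hInt.const_mul C
  have hr_tendsto : Tendsto r atTop (𝓝 0) := by
    have hlim : ∀ p : M × ℝ, Tendsto (fun k ↦ (ρ p.2 p.1 - c₀) ^ 2 * (L k p.1 * Real.exp (-V p.1)))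
        atTop (𝓝 0) := fun p ↦ by
      refine tendsto_const_nhds.congr' ?_
      filter_upwards [hη.toIsCutoffExhaustion.weightedLaplacian_eventually_eq_zero V p.1] with k hk
      rw [show L k p.1 = 0 from hk, zero_mul, mul_zero]
    have h := tendsto_integral_of_dominated_convergence
      (fun p : M × ℝ ↦ C * ((ρ p.2 p.1 - c₀) ^ 2 * Real.exp (-V p.1))) hr_meas hdom
      (fun k ↦ Eventually.of_forall (hr_bound k)) (Eventually.of_forall hlim)
    simpa [hr] using h
  have hr_le : ∀ k, r k ≤ C * B := fun k ↦ by
    calc r k ≤ ‖r k‖ := Real.le_norm_self _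
      _ ≤ ∫ p, ‖(ρ p.2 p.1 - c₀) ^ 2 * (L k p.1 * Real.exp (-V p.1))‖ ∂ν :=
          norm_integral_le_integral_norm _
      _ ≤ ∫ p, C * ((ρ p.2 p.1 - c₀) ^ 2 * Real.exp (-V p.1)) ∂ν :=
          integral_mono_of_nonneg (Eventually.of_forall fun p ↦ norm_nonneg _) hdom
            (Eventually.of_forall (hr_bound k))
      _ = C * B := integral_const_mul _ _
  -- Step 4: `∫ η_k F ≤ (A + r k) / 2 ≤ (A + C B) / 2`
  have hI_le : ∀ k, ∫ p, η k p.1 * F p ∂ν ≤ (A + r k) / 2 := fun k ↦ by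
    have e : ∫ p, η k p.1 * F p ∂ν = ∫ p, g.gradSq (ρ p.2) p.1 * (η k p.1 * Real.exp (-V p.1)) ∂ν :=
      integral_congr_ae (Eventually.of_forall fun p ↦ by simp only [hFdef]; ring)
    rw [e]
    linarith [hid k, hE0 k, hET k]
  -- Step 5: Fatou gives the integrability of `F = |∇ρ|² e^{-V}` on the strip
  have hgradc : ContinuousOn (fun p : M × ℝ ↦ g.gradSq (ρ p.2) p.1) (univ ×ˢ O) :=
    (contMDiffOn_gradSq_family g hO.uniqueDiffOn hρ).continuousOn
  have hFm : AEStronglyMeasurable F ν :=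
    aestronglyMeasurable_strip μ ((hgradc.mono (prod_mono le_rfl (Ioo_subset_Icc_self.trans hTO))).mul
      (hec.comp continuous_fst).continuousOn)
  have hF0 : ∀ p, 0 ≤ F p := fun p ↦ mul_nonneg (g.gradSq_nonneg hg _ _) (Real.exp_nonneg _)
  have hχF : ∀ k, Integrable (fun p : M × ℝ ↦ η k p.1 * F p) ν := fun k ↦ by
    have hwk : Continuous fun x ↦ η k x * Real.exp (-V x) := (hηs k).continuous.mul hec
    have hwkc : HasCompactSupport fun x ↦ η k x * Real.exp (-V x) := (hηc k).mul_right
    have h := integrable_strip_mul_of_hasCompactSupport μ (hgradc.mono (prod_mono le_rfl hTO))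
      hwk hwkc
    exact h.congr (Eventually.of_forall fun p ↦ by simp only [hFdef]; ring)
  have hFint : Integrable F ν :=
    CarrilloNi2009_shrinkerLSI.integrable_of_forall_integral_cutoff_mul_le hFm hF0
      (fun k p ↦ (hη01 k p.1).1) hχF (fun p ↦ hη.toIsCutoffExhaustion.tendsto_one p.1) (K := (A + C * B) / 2)
      fun k ↦ (hI_le k).trans (by linarith [hr_le k])
  -- Step 6: `∫ η_k F → ∫ F` (dominated convergence) and the bound
  have hI_tendsto : Tendsto (fun k ↦ ∫ p, η k p.1 * F p ∂ν) atTop (𝓝 (∫ p, F p ∂ν)) := by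
    refine tendsto_integral_of_dominated_convergence F (fun k ↦ (hχF k).aestronglyMeasurable) hFint
      (fun k ↦ Eventually.of_forall fun p ↦ ?_) (Eventually.of_forall fun p ↦ ?_)
    · rw [Real.norm_eq_abs, abs_of_nonneg (mul_nonneg (hη01 k p.1).1 (hF0 p))]
      exact mul_le_of_le_one_left (hF0 p) (hη01 k p.1).2
    · simpa using (hη.toIsCutoffExhaustion.tendsto_one p.1).mul_const (F p)
  have hb_tendsto : Tendsto (fun k ↦ (A + r k) / 2) atTop (𝓝 ((A + 0) / 2)) :=
    (tendsto_const_nhds.add hr_tendsto).div_const 2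
  have hfinal : ∫ p, F p ∂ν ≤ (A + 0) / 2 := le_of_tendsto_of_tendsto' hI_tendsto hb_tendsto hI_le
  refine ⟨hFint, ?_⟩
  have hgoal : ∫ p, F p ∂ν ≤ 1 / 2 * A := by linarith [hfinal]
  simpa only [hFdef] using hgoal

end Energy

section GradientDecay

variable {n : ℕ} {M : Type*} [TopologicalSpace M] [T2Space M] [SecondCountableTopology M]
  [ChartedSpace (EuclideanSpace ℝ (Fin n)) M] [IsManifold (𝓡 n) ∞ M] [T3Space M]
  [MeasurableSpace M] [BorelSpace M]
  {g : PseudoRiemannianMetric (𝓡 n) ∞ (EuclideanSpace ℝ (Fin n)) (TangentSpace (𝓡 n) : M → Type _)}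
  [g.HasLeviCivita]

omit [T2Space M] [SecondCountableTopology M] [T3Space M] [MeasurableSpace M] [BorelSpace M] in
/-- **`∂ₛ|∇u|² = 2 g⁻¹(du, d(Lu))` along the weighted heat flow, open time set.** If `u` is smooth
on `M × O` (`O` open) and `∂ₛu(t, ·) = Lu(t, ·)` on `M` at a time `t ∈ O`, then
`∂ₛ|∇u|²(t, x) = 2 g⁻¹(du(t), d(Lu(t)))(x)` — the chart computation of
`derivWithin_gradSq_of_heatFlow` (`WeightedHeatFlowAPriori.lean`, time set `[0, ∞)`) with the time
set `O` (`MetricCoord.IsMetricOn.hasDerivWithinAt_gradSqAt_static`). [folklore] -/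
theorem deriv_gradSq_of_heatFlow_isOpen {V : M → ℝ} (hV : ContMDiff (𝓡 n) 𝓘(ℝ, ℝ) ∞ V)
    {u : ℝ → M → ℝ} {O : Set ℝ} (hO : IsOpen O)
    (hu : ContMDiffOn ((𝓡 n).prod 𝓘(ℝ, ℝ)) 𝓘(ℝ, ℝ) ∞ (fun p : M × ℝ ↦ u p.2 p.1) (univ ×ˢ O))
    {t : ℝ} (ht : t ∈ O)
    (heq : ∀ x, deriv (fun s ↦ u s x) t = g.dalembertian (u t) x -
      g.innerDual x (mvfderiv (𝓡 n) V x).toLinearMap (mvfderiv (𝓡 n) (u t) x).toLinearMap)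
    (x : M) :
    deriv (fun s ↦ g.gradSq (u s) x) t =
      2 * g.innerDual x (mvfderiv (𝓡 n) (u t) x).toLinearMap
        (mvfderiv (𝓡 n) (fun y ↦ g.dalembertian (u t) y -
          g.innerDual y (mvfderiv (𝓡 n) V y).toLinearMap
            (mvfderiv (𝓡 n) (u t) y).toLinearMap) x).toLinearMap := by
  have hS : UniqueDiffOn ℝ O := hO.uniqueDiffOn
  have hS' : O ⊆ closure (interior O) := by rw [hO.interior_eq]; exact subset_closure
  -- the chart at `x`
  set G := chartRep (𝓡 n) (fun _ ↦ g) x 0 with hGdef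
  have hGm : MetricCoord.IsMetricOn G (extChartAt (𝓡 n) x).target :=
    OpensChart.isMetricOn_repr (val_chartPullback_eq_chartRep (fun _ : ℝ ↦ g) x 0)
  set Fh : ℝ → EuclideanSpace ℝ (Fin n) → ℝ := fun s z ↦ u s ((extChartAt (𝓡 n) x).symm z)
    with hFhdef
  have hu0 : extChartAt (𝓡 n) x x ∈ (extChartAt (𝓡 n) x).target := mem_extChartAt_target x
  set u₀ : chartTarget (𝓡 n) x := ⟨extChartAt (𝓡 n) x x, hu0⟩ with hu₀def
  have hΦu₀ : chartInv (𝓡 n) x u₀ = x := extChartAt_to_inv x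
  have hslice : ∀ s ∈ O, ContMDiff (𝓡 n) 𝓘(ℝ, ℝ) ∞ (u s) := fun s hs ↦
    contMDiff_slice_of_contMDiffOn hu hs
  have hFh : ContDiffOn ℝ ∞ (fun p : EuclideanSpace ℝ (Fin n) × ℝ ↦ Fh p.2 p.1)
      ((extChartAt (𝓡 n) x).target ×ˢ O) :=
    contDiffOn_family_comp_extChartAt_symm hu x
  have hut : ContMDiff (𝓡 n) 𝓘(ℝ, ℝ) ∞ (u t) := hslice t ht
  have hud : ∀ y, MDifferentiableAt (𝓡 n) 𝓘(ℝ, ℝ) (u t) y := fun y ↦ hut.mdifferentiableAt (by simp)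
  have hLs : ContMDiff (𝓡 n) 𝓘(ℝ, ℝ) ∞ (fun y ↦ g.dalembertian (u t) y -
      g.innerDual y (mvfderiv (𝓡 n) V y).toLinearMap (mvfderiv (𝓡 n) (u t) y).toLinearMap) :=
    (contMDiff_dalembertian g hut).sub (contMDiff_innerDual g hV hut)
  have hLd : MDifferentiableAt (𝓡 n) 𝓘(ℝ, ℝ) (fun y ↦ g.dalembertian (u t) y -
      g.innerDual y (mvfderiv (𝓡 n) V y).toLinearMap (mvfderiv (𝓡 n) (u t) y).toLinearMap)
      (chartInv (𝓡 n) x u₀) :=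
    hLs.mdifferentiableAt (by simp)
  -- (a) `|∇u_s|²(x)` read in the chart, for `s ∈ O`
  have hgrad : ∀ s ∈ O, g.gradSq (u s) x =
      MetricCoord.gradSqAt G (Fh s) (extChartAt (𝓡 n) x x) := by
    intro s hs
    have h := gradSq_chartInv_eq g x u₀ (F := u s) ((hslice s hs).mdifferentiableAt (by simp))
    rw [hΦu₀] at h
    exact h
  have hderiv : derivWithin (fun s ↦ g.gradSq (u s) x) O t =
      derivWithin (fun s ↦ MetricCoord.gradSqAt G (Fh s) (extChartAt (𝓡 n) x x)) O t :=
    derivWithin_congr (fun s hs ↦ hgrad s hs) (hgrad t ht)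
  -- (b) the coordinate time derivative
  have hcoord := (hGm.hasDerivWithinAt_gradSqAt_static hS hS' hFh hu0 ht).derivWithin (hS t ht)
  -- (c) `∂ₜû = (Lu) ∘ φ⁻¹` near `φ x`
  have hrep : MetricCoord.tDerivFun Fh O t =ᶠ[𝓝 (extChartAt (𝓡 n) x x)]
      ((fun y ↦ g.dalembertian (u t) y -
        g.innerDual y (mvfderiv (𝓡 n) V y).toLinearMap (mvfderiv (𝓡 n) (u t) y).toLinearMap) ∘
        (extChartAt (𝓡 n) x).symm) := by
    filter_upwards [(isOpen_extChartAt_target x).mem_nhds hu0] with z hz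
    simp only [MetricCoord.tDerivFun, Function.comp_apply]
    rw [derivWithin_of_isOpen hO ht]
    exact heq _
  -- (d) the bridge for `g⁻¹(du, d(Lu))`
  have hI : g.innerDual x (mvfderiv (𝓡 n) (u t) x).toLinearMap
      (mvfderiv (𝓡 n) (fun y ↦ g.dalembertian (u t) y -
        g.innerDual y (mvfderiv (𝓡 n) V y).toLinearMap
          (mvfderiv (𝓡 n) (u t) y).toLinearMap) x).toLinearMap =
      fderiv ℝ (MetricCoord.tDerivFun Fh O t) (extChartAt (𝓡 n) x x)
        (MetricCoord.sharpAt G (extChartAt (𝓡 n) x x)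
          (fderiv ℝ (Fh t) (extChartAt (𝓡 n) x x))) := by
    have h := innerDual_chartInv_eq g x u₀ (hud _) hLd
    rw [hΦu₀] at h
    rw [h, MetricCoord.apply_sharpAt_comm (hGm.isInvertible _ hu0) (hGm.symm _ hu0),
      hrep.fderiv_eq]
    rfl
  rw [← derivWithin_of_isOpen hO ht, hderiv, hcoord, hI]


/-- **Gradient decay `|∇ρ(s)|² ≤ e^{-2Ks} sup|∇ρ₀|²` along the weighted heat flow on a complete
weighted manifold with `Ric + Hess V ≥ K g`** and weighted cut-offs: `z = e^{2Ks}|∇ρ|² − G₀` is a subsolution (`∂ₛ|∇ρ|² = 2g⁻¹(dρ, d(Lρ))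
≤ L|∇ρ|² − 2K|∇ρ|²` by `weightedBochner_pointwise_ge`, and `L(e^{2Ks}|∇ρ|² − G₀) = e^{2Ks}L|∇ρ|²`)
with `z(0) ≤ 0` and `z₊ e^{-V} ≤ e^{2|K|T}|∇ρ|² e^{-V} ∈ L¹` of the strip, so `z ≤ 0` by the weak
maximum principle `weightedMaxPrinciple`. The closed case is `heatFlow_gradSq_le`
(`WeightedHeatFlowAPriori.lean`). [cite: CarrilloNi2009, §3 (C(K,∞), p. 8)] -/
theorem IsWeightedHeatSolOn.gradSq_le_exp {V : M → ℝ} {ρ : ℝ → M → ℝ} {O : Set ℝ} {T : ℝ}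
    (hsol : IsWeightedHeatSolOn g V ρ O T) (hg : g.IsRiemannian) (hV : ContMDiff (𝓡 n) 𝓘(ℝ, ℝ) ∞ V)
    {K : ℝ} (hRic : ∀ (x : M) (X : TangentSpace (𝓡 n) x), K * g.val x X X ≤ g.ricci x X X + g.hessian V x X X)
    {η : ℕ → M → ℝ} {C : ℝ} (hη : IsWeightedCutoff g V η C) (hT : 0 < T)
    (hint : Integrable (fun p : M × ℝ ↦ g.gradSq (ρ p.2) p.1 * Real.exp (-V p.1))
      ((g.riemVolume.prod (volume : Measure ℝ)).restrict (univ ×ˢ Ioo 0 T)))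
    {G₀ : ℝ} (hG₀ : ∀ x, g.gradSq (ρ 0) x ≤ G₀) {s : ℝ} (hs : s ∈ Icc 0 T) (x : M) :
    g.gradSq (ρ s) x ≤ Real.exp (-2 * K * s) * G₀ := by
  obtain ⟨hO, hTO, hρ, heq⟩ := hsol
  -- the subsolution `z = e^{2Ks} |∇ρ|² − G₀`
  set z : ℝ → M → ℝ := fun r y ↦ Real.exp (2 * K * r) * g.gradSq (ρ r) y + (-G₀) with hz
  have hρs : ∀ r ∈ O, ContMDiff (𝓡 n) 𝓘(ℝ, ℝ) ∞ (ρ r) := fun r hr ↦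
    contMDiff_slice_of_contMDiffOn hρ hr
  have hG₀0 : 0 ≤ G₀ := (g.gradSq_nonneg hg _ x).trans (hG₀ x)
  -- smoothness of `z` on `M × O`
  have hgradfam := contMDiffOn_gradSq_family g hO.uniqueDiffOn hρ
  have hexpfam : ContMDiff ((𝓡 n).prod 𝓘(ℝ, ℝ)) 𝓘(ℝ, ℝ) ∞
      (fun p : M × ℝ ↦ Real.exp (2 * K * p.2)) :=
    (Real.contDiff_exp.comp (contDiff_const.mul contDiff_id)).comp_contMDiff contMDiff_snd
  have hzs : ContMDiffOn ((𝓡 n).prod 𝓘(ℝ, ℝ)) 𝓘(ℝ, ℝ) ∞ (fun p : M × ℝ ↦ z p.2 p.1) (univ ×ˢ O) :=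
    (hexpfam.contMDiffOn.mul hgradfam).add contMDiffOn_const
  -- the subsolution property
  have hsub : ∀ r ∈ Icc 0 T, ∀ y, deriv (fun r' ↦ z r' y) r ≤ g.dalembertian (z r) y -
      g.innerDual y (mvfderiv (𝓡 n) V y).toLinearMap (mvfderiv (𝓡 n) (z r) y).toLinearMap := by
    intro r hr y
    have hrO := hTO hr
    have hgd : HasDerivAt (fun r' ↦ g.gradSq (ρ r') y) (deriv (fun r' ↦ g.gradSq (ρ r') y) r)
        r := by
      have h := hasDerivWithinAt_time_of_contMDiffOn (I := 𝓡 n) (k := ∞) (by simp)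
        (u := fun r' y ↦ g.gradSq (ρ r') y) hgradfam y hrO
      exact (h.hasDerivAt (hO.mem_nhds hrO)).differentiableAt.hasDerivAt
    have hformula := deriv_gradSq_of_heatFlow_isOpen (g := g) hV hO hρ hrO (heq r hr) y
    have hbochner := weightedBochner_pointwise_ge g hg hV hRic (hρs r hrO) y
    have hzd : HasDerivAt (fun r' ↦ z r' y) (Real.exp (2 * K * r) * (2 * K) * g.gradSq (ρ r) y +
        Real.exp (2 * K * r) * deriv (fun r' ↦ g.gradSq (ρ r') y) r) r := by
      have h1 : HasDerivAt (fun r' : ℝ ↦ Real.exp (2 * K * r')) (Real.exp (2 * K * r) * (2 * K))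
          r := by
        have := ((hasDerivAt_id r).const_mul (2 * K)).exp
        simpa using this
      exact (h1.mul hgd).add_const (-G₀)
    rw [hzd.deriv]
    have h2 : ContMDiffAt (𝓡 n) 𝓘(ℝ, ℝ) 2 (g.gradSq (ρ r)) y :=
      ((contMDiff_gradSq g (hρs r hrO)).of_le (WithTop.coe_le_coe.mpr le_top)).contMDiffAt
    have hLz := weightedLaplacian_affine (g := g) (V := V) h2 (Real.exp (2 * K * r)) (-G₀)
    rw [show z r = fun y' ↦ Real.exp (2 * K * r) * g.gradSq (ρ r) y' + (-G₀) from rfl, hLz,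
      hformula]
    have hE := Real.exp_pos (2 * K * r)
    nlinarith [hbochner, hE]
  have hz0 : ∀ y, z 0 y ≤ 0 := by
    intro y
    simp only [hz, mul_zero, Real.exp_zero, one_mul]
    linarith [hG₀ y]
  -- `z₊ e^{-V}` is integrable on the strip
  have hexpc : Continuous fun y ↦ Real.exp (-V y) := Real.continuous_exp.comp hV.continuous.neg
  have hint' : Integrable (fun p : M × ℝ ↦ max (z p.2 p.1) 0 * Real.exp (-V p.1))
      ((g.riemVolume.prod (volume : Measure ℝ)).restrict (univ ×ˢ Ioo 0 T)) := by
    refine (hint.const_mul (Real.exp (2 * |K| * T))).mono' ?_ ?_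
    · have hcont : ContinuousOn (fun p : M × ℝ ↦ max (z p.2 p.1) 0 * Real.exp (-V p.1))
          (univ ×ˢ O) :=
        (hzs.continuousOn.sup continuousOn_const).mul (hexpc.comp continuous_fst).continuousOn
      exact (hcont.mono (prod_mono le_rfl (Ioo_subset_Icc_self.trans hTO))).aestronglyMeasurable
        (MeasurableSet.univ.prod measurableSet_Ioo)
    · refine ae_restrict_of_forall_mem (MeasurableSet.univ.prod measurableSet_Ioo) fun p hp ↦ ?_
      have hs' : p.2 ∈ Ioo 0 T := hp.2
      have hΓ := g.gradSq_nonneg hg (ρ p.2) p.1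
      have hex := Real.exp_pos (-V p.1)
      have hE := Real.exp_pos (2 * K * p.2)
      have hEle : Real.exp (2 * K * p.2) ≤ Real.exp (2 * |K| * T) := by
        refine Real.exp_le_exp.2 ?_
        have h1 : 2 * K * p.2 ≤ 2 * |K| * p.2 := by nlinarith [le_abs_self K, hs'.1]
        have h2 : 2 * |K| * p.2 ≤ 2 * |K| * T := by nlinarith [abs_nonneg K, hs'.2]
        linarith
      have hmax : max (z p.2 p.1) 0 ≤ Real.exp (2 * K * p.2) * g.gradSq (ρ p.2) p.1 :=
        max_le (by simp only [hz]; linarith) (mul_nonneg hE.le hΓ)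
      rw [Real.norm_eq_abs, abs_of_nonneg (mul_nonneg (le_max_right _ _) hex.le)]
      calc max (z p.2 p.1) 0 * Real.exp (-V p.1)
          ≤ (Real.exp (2 * K * p.2) * g.gradSq (ρ p.2) p.1) * Real.exp (-V p.1) :=
            mul_le_mul_of_nonneg_right hmax hex.le
        _ ≤ (Real.exp (2 * |K| * T) * g.gradSq (ρ p.2) p.1) * Real.exp (-V p.1) :=
            mul_le_mul_of_nonneg_right (mul_le_mul_of_nonneg_right hEle hΓ) hex.le
        _ = Real.exp (2 * |K| * T) * (g.gradSq (ρ p.2) p.1 * Real.exp (-V p.1)) := by ring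
  -- the weak maximum principle
  have hmax := weightedMaxPrinciple hg hV hη hT hO hTO hzs hsub hz0 hint' hs x
  have hle : Real.exp (2 * K * s) * g.gradSq (ρ s) x ≤ G₀ := by
    simp only [hz] at hmax
    linarith
  have hexp : Real.exp (-2 * K * s) * Real.exp (2 * K * s) = 1 := by
    rw [← Real.exp_add]; convert Real.exp_zero using 2; ring
  calc g.gradSq (ρ s) x = Real.exp (-2 * K * s) * (Real.exp (2 * K * s) * g.gradSq (ρ s) x) := by
        rw [← mul_assoc, hexp, one_mul]
    _ ≤ Real.exp (-2 * K * s) * G₀ := mul_le_mul_of_nonneg_left hle (Real.exp_pos _).le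

end GradientDecay

end Literature.Geometry.Riemannian

end
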